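import Mathlib
import HarnessLib
import Literature.Combinatorics.Additive.Kneser
import Literature.Combinatorics.Additive.GrynkiewiczPollardKneserTools
import Literature.Combinatorics.Additive.Vosper

/-!
# Critical pairs and critical trios in a finite abelian group: Kneser's theorem for trios,
# beat stability, Mann's theorem and purification (Boothby–DeVos–Montejano, §§2–6)

Topic `Literature/Combinatorics/Additive`.  Cell `mm-stpp` (D-0046), seat `mm-stpp-lit` (gen 13);
companion of `Kneser.lean` (Kneser's theorem and the `Finset.addStab` stabilizer API),
`GrynkiewiczPollardKneserTools.lean` (coset calculus of `S.addStab`, Kneser's equality case),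
`Vosper.lean` (Vosper's theorem, progressions `IsAP`) and `Chowla.lean` (`olson_card_add'` =
Lemma 5.1 of the source in absolute form).

SOURCE.  T. Boothby, M. DeVos, A. Montejano, *A new proof of Kemperman's theorem*, Integers 15
(2015) #A5 = arXiv:1301.0095 [cite: BoothbyDevosMontejano2013].  That paper re-proves KEMPERMAN'S
STRUCTURE THEOREM for critical pairs `|A + B| < |A| + |B|` in an abelian group (Kemperman, Acta
Math. 103 (1960)) from Kneser's theorem, in the language of TRIOS.  This file formalizes, for a
FINITE abelian group `G` (all sets are then finite; the paper also allows cofinite members of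
infinite groups — `-- TODO(general form)`), the definitions and numbered results of its §§2, 3, 5
and 6 (all of them but the background Theorems 1.1–1.3; Theorem 3.3 = Vosper's theorem restated
for trios is derived at the end from `Vosper.lean`), i.e. the toolkit of that proof short of §4's
Definitions 4.1–4.4 / Theorem 4.5 (the recursive structure theorem itself), §7 (near and fringed
sequences, Lemmas 7.3–7.6) and §8 (the proof of Theorem 4.5):

* §3 vocabulary: `third A B = (−(A + B))ᶜ` (the paper's `\overline{−(A+B)}`), `IsTrio A B C`
  (`0 ∉ A + B + C`), `trioDeficiency A B C = |A| + |B| + |C| − |G|` (an integer),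
  `IsMaximalTrio`; basic facts: `isTrio_iff_subset_third`, permutation and translation invariance,
  `trioDeficiency_third` (`δ(A,B,third A B) = δ(A,B) = |A| + |B| − |A + B|`),
  `isMaximalTrio_iff` ("`(A,B,C)` is maximal iff `C = third A B`, `B = third A C`, `A = third B C`").
* §2: `IsPurePair` (`stab A = stab B = stab (A+B)`), Observation 2.1 `isPurePair_add_addStab`,
  **Proposition 2.2** `critical_iff_exists_pure_superpair`.
* **Theorem 3.3 (Vosper, version II)** `IsTrio.vosper_trio` (last section; `G = ℤ/pℤ`): a critical
  trio with nonempty members has a singleton member or three progressions with one common difference.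
* **Proposition 3.4** `purePair_critical_iff_maximalTrio` and **Theorem 3.5 (Kneser, version II)**
  `IsMaximalTrio.addStab_eq` / `IsMaximalTrio.trioDeficiency_eq_card_addStab`: a maximal critical
  trio has `stab A = stab B = stab C = H` and deficiency exactly `|H|`.
* §5: finite subgroups are handled as finsets `H` with `IsSubgroupCarrier H` (`0 ∈ H`, closed under
  subtraction; e.g. every `S.addStab`), and the paper's closure condition "`[A]` is an `H`-coset" as
  `ClosureIs H A`; **Lemma 5.1** in relative form `card_add_two_mul_card_le_of_closureIs`
  (`|A + B| ≥ ½|A| + |B|`), **Lemma 5.2** `exists_quasistable_of_critical` /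
  `card_add_card_add_le_of_critical` (`A + B` is `H`-quasistable and `δ(H,B) ≥ δ(A,B)`), and
  **Lemma 5.3 (beat stability)** `IsMaximalTrio.pureBeat_or_impureBeat` in normal position
  (`A ⊆ H`): either `A = H` and `B`, `C` are `H`-stable (a PURE BEAT), or after one translation
  `(A, g + B, −g + C)` of the trio, `(g + B) ∖ H` is `H`-stable and `g + B`, `−g + C` both meet `H`
  (an IMPURE BEAT, Definition 4.3, whose continuation is `(A, (g+B) ∩ H, (−g+C) ∩ H)`).
* §6: the set deficiency `setDeficiency A = max {δ(A,B) : B ≠ ∅, A + B ≠ G}` (Definition before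
  Thm 6.1), **Theorem 6.1 (Mann)** `exists_subgroupCarrier_setDeficiency_eq` (the maximum is attained
  at a finite subgroup `H` with `A + H ≠ G`), **Lemma 6.2** `card_add_card_add_le_of_subset_carrier`
  (`B ⊆ H`, `(A,H)` critical ⇒ `δ(A,B) ≤ δ(A,H)`), and **Lemma 6.3 (purification)**
  `IsTrio.trioDeficiency_le_purify` with its pair form `card_add_union_coset_le`.

Deficiencies are written without truncated subtraction wherever they may be negative (as `ℤ`, or
as rearranged `ℕ` inequalities); "critical" is spelled `#(A + B) < #A + #B` for pairs and
`0 < trioDeficiency A B C` for trios; "nontrivial" is spelled as the nonemptiness of the members.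
Deviations from print: NONE in the mathematics; finite `G` throughout (so Claim-type case splits on
"`H` infinite" disappear); Lemma 5.1 is proved directly from Kneser's theorem inside a coset of
`H` (the paper applies the absolute statement in the subgroup `[A]`; the absolute statement is
`olson_card_add'` in `Chowla.lean`); in Lemma 5.3 "similar trio" (any composition of permutations
and translations `(A + g, B − g, C)`) is replaced by the ONE translation the proof uses, named
explicitly.  Everything here is PROVED (0 named facts); census-silent for the cell `mm-stpp`
(LIT-INDEX §11 (b): Kemperman's structure theorem was «TREE: ABSENT, XL»; this file is its
§§2–6).

ROADMAP FOR §§7–8 (not in this file): Def 7.1/7.2 near and fringed `R`-sequences for `H < G` with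
`G/H` cyclic generated by `R`; Lemma 7.3 (uses the ℤ critical-pair lemma = the tree's
`CriticalPairsOfIntegers.lean`), Lemma 7.4 (double minimal counterexample), Lemma 7.5 (sequence
stability), Lemma 7.6; §8 Claims 6–12 (minimal counterexample over all finite abelian groups:
needs passing to `G ⧸ stab` and to the subgroup `H`, i.e. an induction over the group) and the
recursive statement Thm 4.5 with Definitions 4.1–4.4 (pure/impure beats and chords,
continuations) as an inductive predicate.

## References
* T. Boothby, M. DeVos, A. Montejano, *A new proof of Kemperman's theorem*, Integers 15 (2015)
  #A5, arXiv:1301.0095 — held `paper:arxiv-1301.0095`, pp. 1–13 (whole paper) read 2026-08-28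
  [cite: BoothbyDevosMontejano2013, Prop 2.2; Thm 3.3; Prop 3.4; Thm 3.5; Lemma 5.1; Lemma 5.2;
  Lemma 5.3; Thm 6.1; Lemma 6.2; Lemma 6.3].
* A. G. Vosper, J. London Math. Soc. 31 (1956) — through `Vosper.lean` (`vosper_inverse`,
  `IsAP.add/neg/compl`) [cite: Vosper1956, main theorem].
* J. H. B. Kemperman, *On small sumsets in an abelian group*, Acta Math. 103 (1960) 63–88 (the
  structure theorem; not held, cited through the source).
* H. B. Mann's theorem (Thm 6.1 of the source, attributed there to Mann without locator).
* M. Kneser, Math. Z. 58 (1953) — through `Kneser.lean` [cite: Kneser1953].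
-/

namespace Literature.Combinatorics.Additive

open Finset Grynkiewicz
open scoped Pointwise

variable {G : Type*} [AddCommGroup G]

/-! ## Finite subgroups as finsets -/

/-- `H : Finset G` is (the carrier of) a finite subgroup: `0 ∈ H` and `H` is closed under
subtraction.  (The paper's finite subgroups `H ≤ G`; e.g. every stabilizer `S.addStab` of a
nonempty `S`.) [cite: BoothbyDevosMontejano2013, §1] -/
def IsSubgroupCarrier (H : Finset G) : Prop :=
  (0 : G) ∈ H ∧ ∀ ⦃a⦄, a ∈ H → ∀ ⦃b⦄, b ∈ H → a - b ∈ H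

namespace IsSubgroupCarrier

variable {H K : Finset G}

/-- Unfolding lemma. [cite: BoothbyDevosMontejano2013, §1] -/
theorem iff : IsSubgroupCarrier H ↔ (0 : G) ∈ H ∧ ∀ ⦃a⦄, a ∈ H → ∀ ⦃b⦄, b ∈ H → a - b ∈ H :=
  Iff.rfl

/-- A subgroup carrier is nonempty. [cite: BoothbyDevosMontejano2013, §1] -/
theorem nonempty (hH : IsSubgroupCarrier H) : H.Nonempty := ⟨0, hH.1⟩

/-- `0 ∈ H`. [cite: BoothbyDevosMontejano2013, §1] -/
theorem zero_mem (hH : IsSubgroupCarrier H) : (0 : G) ∈ H := hH.1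

/-- Closure under subtraction. [cite: BoothbyDevosMontejano2013, §1] -/
theorem sub_mem (hH : IsSubgroupCarrier H) {a b : G} (ha : a ∈ H) (hb : b ∈ H) : a - b ∈ H :=
  hH.2 ha hb

/-- Closure under negation. [cite: BoothbyDevosMontejano2013, §1] -/
theorem neg_mem (hH : IsSubgroupCarrier H) {a : G} (ha : a ∈ H) : -a ∈ H := by
  simpa using hH.2 hH.1 ha

/-- Closure under addition. [cite: BoothbyDevosMontejano2013, §1] -/
theorem add_mem (hH : IsSubgroupCarrier H) {a b : G} (ha : a ∈ H) (hb : b ∈ H) : a + b ∈ H := by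
  simpa using hH.2 ha (hH.neg_mem hb)

/-- The additive subgroup with carrier `H`. [cite: BoothbyDevosMontejano2013, §1] -/
def toAddSubgroup (hH : IsSubgroupCarrier H) : AddSubgroup G where
  carrier := H
  zero_mem' := by simpa using hH.1
  add_mem' := fun ha hb => by simpa using hH.add_mem ha hb
  neg_mem' := fun ha => by simpa using hH.neg_mem ha

/-- Its carrier is `H`. [cite: BoothbyDevosMontejano2013, §1] -/
theorem coe_toAddSubgroup (hH : IsSubgroupCarrier H) : (hH.toAddSubgroup : Set G) = H := rfl

/-- Membership in `toAddSubgroup`. [cite: BoothbyDevosMontejano2013, §1] -/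
theorem mem_toAddSubgroup (hH : IsSubgroupCarrier H) {a : G} : a ∈ hH.toAddSubgroup ↔ a ∈ H :=
  Iff.rfl

/-- A finset whose coercion is the carrier of an additive subgroup is a subgroup carrier.
[cite: BoothbyDevosMontejano2013, §1] -/
theorem of_coe_eq (K : AddSubgroup G) (h : (H : Set G) = K) : IsSubgroupCarrier H := by
  refine ⟨?_, fun a ha b hb => ?_⟩
  · rw [← mem_coe, h]; exact K.zero_mem
  · rw [← mem_coe, h] at ha hb ⊢; exact K.sub_mem ha hb

variable [DecidableEq G]

/-- `H + H = H`. [cite: BoothbyDevosMontejano2013, §1] -/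
theorem add_self (hH : IsSubgroupCarrier H) : H + H = H := by
  refine Subset.antisymm ?_ fun x hx => mem_add.2 ⟨x, hx, 0, hH.1, add_zero x⟩
  rintro x hx
  obtain ⟨a, ha, b, hb, rfl⟩ := mem_add.1 hx
  exact hH.add_mem ha hb

/-- A subgroup carrier is its own stabilizer: `H.addStab = H`. [cite: BoothbyDevosMontejano2013, §1] -/
theorem addStab_eq (hH : IsSubgroupCarrier H) : H.addStab = H := by
  refine Subset.antisymm ?_ ?_
  · intro a ha
    have h := (mem_addStab hH.nonempty).1 ha
    have : a +ᵥ (0 : G) ∈ a +ᵥ H := vadd_mem_vadd_finset_iff a |>.2 hH.1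
    rw [h, vadd_eq_add, add_zero] at this
    exact this
  · rw [← add_subset_left_iff hH.nonempty, hH.add_self]

/-- The stabilizer of a nonempty finset is a subgroup carrier. [cite: BoothbyDevosMontejano2013, §1] -/
theorem of_addStab {S : Finset G} (hS : S.Nonempty) : IsSubgroupCarrier S.addStab :=
  ⟨zero_mem_addStab' hS, fun _ ha _ hb => sub_mem_addStab ha hb⟩

/-- `-H = H`. [cite: BoothbyDevosMontejano2013, §1] -/
theorem neg_eq (hH : IsSubgroupCarrier H) : -H = H := by
  rw [← hH.addStab_eq, neg_addStab, hH.addStab_eq]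

/-- The intersection of two subgroup carriers is one. [cite: BoothbyDevosMontejano2013, §1] -/
theorem inter (hH : IsSubgroupCarrier H) (hK : IsSubgroupCarrier K) : IsSubgroupCarrier (H ∩ K) :=
  ⟨mem_inter.2 ⟨hH.1, hK.1⟩, fun _ ha _ hb =>
    mem_inter.2 ⟨hH.2 (mem_inter.1 ha).1 (mem_inter.1 hb).1, hK.2 (mem_inter.1 ha).2 (mem_inter.1 hb).2⟩⟩

/-- Membership in a coset: `x ∈ a +ᵥ H ↔ x − a ∈ H`. [cite: BoothbyDevosMontejano2013, §1] -/
theorem mem_coset_iff (hH : IsSubgroupCarrier H) {a x : G} : x ∈ a +ᵥ H ↔ x - a ∈ H := by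
  rw [← hH.addStab_eq]; exact Grynkiewicz.mem_coset_iff

/-- Two cosets are equal or disjoint. [cite: BoothbyDevosMontejano2013, §1] -/
theorem coset_eq_or_disjoint (hH : IsSubgroupCarrier H) (a b : G) :
    a +ᵥ H = b +ᵥ H ∨ Disjoint (a +ᵥ H) (b +ᵥ H) := by
  rw [← hH.addStab_eq]; exact Grynkiewicz.coset_eq_or_disjoint a b

/-- `b ∈ a +ᵥ H ⇒ b +ᵥ H = a +ᵥ H`. [cite: BoothbyDevosMontejano2013, §1] -/
theorem coset_eq_of_mem (hH : IsSubgroupCarrier H) {a b : G} (hb : b ∈ a +ᵥ H) :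
    b +ᵥ H = a +ᵥ H := by
  rw [← hH.addStab_eq] at hb ⊢; exact Grynkiewicz.coset_eq_of_mem hb

/-- `a ∈ a +ᵥ H`. [cite: BoothbyDevosMontejano2013, §1] -/
theorem mem_coset_self (hH : IsSubgroupCarrier H) (a : G) : a ∈ a +ᵥ H := by
  rw [hH.mem_coset_iff, sub_self]; exact hH.1

/-- A coset is `H`-stable: `(a +ᵥ H) + H = a +ᵥ H`. [cite: BoothbyDevosMontejano2013, §1] -/
theorem coset_add (hH : IsSubgroupCarrier H) (a : G) : (a +ᵥ H) + H = a +ᵥ H := by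
  rw [vadd_add_assoc, hH.add_self]

/-- An `H`-stable set contains the coset of each of its points. [cite: BoothbyDevosMontejano2013, §1] -/
theorem coset_subset_of_stable (hH : IsSubgroupCarrier H) {P : Finset G} (hP : P + H = P) {p : G}
    (hp : p ∈ P) : p +ᵥ H ⊆ P := by
  rw [← hH.addStab_eq] at hP ⊢; exact coset_subset_of_periodic hP hp

/-- `A ⊆ A + H`. [cite: BoothbyDevosMontejano2013, §1] -/
theorem subset_add (hH : IsSubgroupCarrier H) (A : Finset G) : A ⊆ A + H := fun a ha =>
  mem_add.2 ⟨a, ha, 0, hH.1, add_zero a⟩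

/-- `A + H` is `H`-stable. [cite: BoothbyDevosMontejano2013, §1] -/
theorem add_add_self (hH : IsSubgroupCarrier H) (A : Finset G) : A + H + H = A + H := by
  rw [add_assoc, hH.add_self]

/-- `H`-stable sets are exactly those whose stabilizer contains `H` (for nonempty sets).
[cite: BoothbyDevosMontejano2013, §1] -/
theorem add_eq_self_iff_subset_addStab (hH : IsSubgroupCarrier H) {P : Finset G}
    (hP : P.Nonempty) : P + H = P ↔ H ⊆ P.addStab := by
  rw [← add_subset_left_iff hP]
  exact ⟨fun h => h.le, fun h => Subset.antisymm h (hH.subset_add P)⟩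

/-- The cardinality of an `H`-stable set is a multiple of `|H|`. [cite: BoothbyDevosMontejano2013, §1] -/
theorem card_dvd_of_stable (hH : IsSubgroupCarrier H) {P : Finset G} (hP : P + H = P) :
    #H ∣ #P := by
  rcases P.eq_empty_or_nonempty with rfl | hPne
  · simp
  have hsub : H ⊆ P.addStab := (hH.add_eq_self_iff_subset_addStab hPne).1 hP
  have h1 : #H ∣ #P.addStab := by
    have := card_addStab_dvd_card_addStab hH.nonempty (hH.addStab_eq.symm ▸ hsub)
    rwa [hH.addStab_eq] at this
  exact h1.trans (card_addStab_dvd_card P)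

/-- Lagrange for carriers: `K ⊆ H` subgroup carriers ⇒ `|K| ∣ |H|`. [cite: BoothbyDevosMontejano2013, §1] -/
theorem card_dvd_of_subset (hK : IsSubgroupCarrier K) (hH : IsSubgroupCarrier H) (h : K ⊆ H) :
    #K ∣ #H :=
  hK.card_dvd_of_stable (Subset.antisymm
    (fun x hx => by obtain ⟨a, ha, b, hb, rfl⟩ := mem_add.1 hx; exact hH.add_mem ha (h hb))
    (hK.subset_add H))

end IsSubgroupCarrier

variable [DecidableEq G]

/-! ## §3. Trios -/

/-- The THIRD SET of a pair: `third A B = (−(A + B))ᶜ`, the paper's `\overline{−(A + B)}` — the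
largest `C` with `0 ∉ A + B + C`. [cite: BoothbyDevosMontejano2013, §3] -/
def third [Fintype G] (A B : Finset G) : Finset G := (-(A + B))ᶜ

/-- `(A, B, C)` is a TRIO: `0 ∉ A + B + C` (Definition 3.1; in a finite group every set is finite).
[cite: BoothbyDevosMontejano2013, Def 3.1] -/
def IsTrio (A B C : Finset G) : Prop := (0 : G) ∉ A + B + C

/-- The DEFICIENCY of a trio in a finite group: `δ(A,B,C) = |A| + |B| + |C| − |G|` (Definition 3.2,
finite case), as an integer. [cite: BoothbyDevosMontejano2013, Def 3.2] -/
def trioDeficiency [Fintype G] (A B C : Finset G) : ℤ :=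
  (#A : ℤ) + #B + #C - Fintype.card G

/-- A trio is MAXIMAL if it has no proper supertrio. [cite: BoothbyDevosMontejano2013, §3] -/
def IsMaximalTrio (A B C : Finset G) : Prop :=
  IsTrio A B C ∧ ∀ ⦃A' B' C' : Finset G⦄, A ⊆ A' → B ⊆ B' → C ⊆ C' → IsTrio A' B' C' →
    A' = A ∧ B' = B ∧ C' = C

section Trio

variable {A B C : Finset G}

/-- Unfolding lemma. [cite: BoothbyDevosMontejano2013, Def 3.1] -/
theorem isTrio_iff : IsTrio A B C ↔ (0 : G) ∉ A + B + C := Iff.rfl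

/-- `0 ∈ A + B + C` iff some `c ∈ C` has `−c ∈ A + B`. [cite: BoothbyDevosMontejano2013, §3] -/
theorem zero_mem_add_add_iff : (0 : G) ∈ A + B + C ↔ ∃ c ∈ C, -c ∈ A + B := by
  constructor
  · intro h
    obtain ⟨x, hx, c, hc, hxc⟩ := mem_add.1 h
    exact ⟨c, hc, by rwa [show -c = x from (neg_eq_of_add_eq_zero_left hxc).symm ▸ rfl]⟩
  · rintro ⟨c, hc, hc'⟩
    exact mem_add.2 ⟨-c, hc', c, hc, neg_add_cancel c⟩

/-- A trio stays a trio under cyclic permutation. [cite: BoothbyDevosMontejano2013, §4] -/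
theorem IsTrio.rotate (h : IsTrio A B C) : IsTrio B C A := by
  unfold IsTrio at h ⊢; rwa [add_right_comm, add_comm B A]

/-- A trio stays a trio under swapping the first two members. [cite: BoothbyDevosMontejano2013, §4] -/
theorem IsTrio.swap (h : IsTrio A B C) : IsTrio B A C := by
  unfold IsTrio at h ⊢; rwa [add_comm B A]

/-- A trio stays a trio under swapping the last two members. [cite: BoothbyDevosMontejano2013, §4] -/
theorem IsTrio.swap_right (h : IsTrio A B C) : IsTrio A C B := by
  unfold IsTrio at h ⊢; rwa [add_right_comm]

/-- All six permutations at once. [cite: BoothbyDevosMontejano2013, §4] -/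
theorem isTrio_comm : IsTrio A B C ↔ IsTrio B A C := ⟨IsTrio.swap, IsTrio.swap⟩

/-- Cyclic form. [cite: BoothbyDevosMontejano2013, §4] -/
theorem isTrio_rotate : IsTrio A B C ↔ IsTrio B C A :=
  ⟨IsTrio.rotate, fun h => h.rotate.rotate⟩

/-- `(g + A) + (−g + B) = A + B`. [cite: BoothbyDevosMontejano2013, §4] -/
theorem vadd_add_neg_vadd (g : G) (A B : Finset G) : (g +ᵥ A) + (-g +ᵥ B) = A + B := by
  calc (g +ᵥ A) + (-g +ᵥ B) = g +ᵥ (A + (-g +ᵥ B)) := vadd_add_assoc g A _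
    _ = g +ᵥ ((-g +ᵥ B) + A) := by rw [add_comm A]
    _ = g +ᵥ (-g +ᵥ (B + A)) := by rw [vadd_add_assoc (-g) B A]
    _ = A + B := by rw [← add_vadd, add_neg_cancel, zero_vadd, add_comm]

/-- The translation `(A + g, B − g, C)` of a trio is a trio ("similar" trios, §4).
[cite: BoothbyDevosMontejano2013, §4] -/
theorem IsTrio.translate (h : IsTrio A B C) (g : G) : IsTrio (g +ᵥ A) (-g +ᵥ B) C := by
  unfold IsTrio at h ⊢
  rwa [vadd_add_neg_vadd]

/-- Translation form on the last two members: `(A, g + B, −g + C)`. [cite: BoothbyDevosMontejano2013, §4] -/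
theorem IsTrio.translate_right (h : IsTrio A B C) (g : G) : IsTrio A (g +ᵥ B) (-g +ᵥ C) :=
  ((h.rotate.translate g).rotate).rotate

/-- Subtrios of trios are trios. [cite: BoothbyDevosMontejano2013, §3] -/
theorem IsTrio.mono {A' B' C' : Finset G} (h : IsTrio A' B' C') (hA : A ⊆ A') (hB : B ⊆ B')
    (hC : C ⊆ C') : IsTrio A B C :=
  fun h0 => h (add_subset_add (add_subset_add hA hB) hC h0)

variable [Fintype G]

/-- Membership in the third set: `c ∈ third A B ↔ −c ∉ A + B`. [cite: BoothbyDevosMontejano2013, §3] -/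
theorem mem_third {c : G} : c ∈ third A B ↔ -c ∉ A + B := by
  rw [third, mem_compl, mem_neg']

/-- The third set is symmetric in `A`, `B`. [cite: BoothbyDevosMontejano2013, §3] -/
theorem third_comm (A B : Finset G) : third A B = third B A := by
  rw [third, third, add_comm]

/-- The third set is antitone. [cite: BoothbyDevosMontejano2013, §3] -/
theorem third_mono {A' B' : Finset G} (hA : A ⊆ A') (hB : B ⊆ B') : third A' B' ⊆ third A B :=
  fun _ hc => mem_third.2 fun h => mem_third.1 hc (add_subset_add hA hB h)

/-- `(A, B, C)` is a trio iff `C ⊆ third A B`. [cite: BoothbyDevosMontejano2013, §3] -/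
theorem isTrio_iff_subset_third : IsTrio A B C ↔ C ⊆ third A B := by
  rw [IsTrio, zero_mem_add_add_iff]
  constructor
  · intro h c hc
    exact mem_third.2 fun h' => h ⟨c, hc, h'⟩
  · rintro h ⟨c, hc, hc'⟩
    exact mem_third.1 (h hc) hc'

/-- `(A, B, third A B)` is a trio. [cite: BoothbyDevosMontejano2013, §3] -/
theorem isTrio_third (A B : Finset G) : IsTrio A B (third A B) :=
  isTrio_iff_subset_third.2 Subset.rfl

/-- `|third A B| = |G| − |A + B|`. [cite: BoothbyDevosMontejano2013, §3] -/
theorem card_third (A B : Finset G) : #(third A B) = Fintype.card G - #(A + B) := by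
  rw [third, card_compl, card_neg]

/-- `|third A B| + |A + B| = |G|`. [cite: BoothbyDevosMontejano2013, §3] -/
theorem card_third_add_card_add (A B : Finset G) : #(third A B) + #(A + B) = Fintype.card G := by
  rw [card_third, Nat.sub_add_cancel (card_le_univ _)]

/-- The trio `(A, B, third A B)` has the deficiency of the pair: `δ(A,B,third A B) = |A| + |B| − |A + B|`
("`δ(A,B) = δ(A,B,C)`"). [cite: BoothbyDevosMontejano2013, §3] -/
theorem trioDeficiency_third (A B : Finset G) :
    trioDeficiency A B (third A B) = (#A : ℤ) + #B - #(A + B) := by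
  unfold trioDeficiency
  have := card_third_add_card_add A B
  omega

/-- The deficiency of a trio is at most that of the pair of its first two members
(`C ⊆ third A B`). [cite: BoothbyDevosMontejano2013, §3] -/
theorem IsTrio.trioDeficiency_le (h : IsTrio A B C) :
    trioDeficiency A B C ≤ (#A : ℤ) + #B - #(A + B) := by
  rw [← trioDeficiency_third]
  unfold trioDeficiency
  have := card_le_card (isTrio_iff_subset_third.1 h)
  omega

omit [AddCommGroup G] [DecidableEq G] in
/-- The deficiency is invariant under cyclic permutation. [cite: BoothbyDevosMontejano2013, §4] -/
theorem trioDeficiency_rotate (A B C : Finset G) :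
    trioDeficiency B C A = trioDeficiency A B C := by
  unfold trioDeficiency; ring

omit [AddCommGroup G] [DecidableEq G] in
/-- The deficiency is invariant under swapping. [cite: BoothbyDevosMontejano2013, §4] -/
theorem trioDeficiency_swap (A B C : Finset G) :
    trioDeficiency B A C = trioDeficiency A B C := by
  unfold trioDeficiency; ring

omit [AddCommGroup G] [DecidableEq G] in
/-- The deficiency is invariant under swapping the last two. [cite: BoothbyDevosMontejano2013, §4] -/
theorem trioDeficiency_swap_right (A B C : Finset G) :
    trioDeficiency A C B = trioDeficiency A B C := by
  unfold trioDeficiency; ring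

/-- The deficiency is invariant under translations of the members. [cite: BoothbyDevosMontejano2013, §4] -/
theorem trioDeficiency_translate (A B C : Finset G) (a b c : G) :
    trioDeficiency (a +ᵥ A) (b +ᵥ B) (c +ᵥ C) = trioDeficiency A B C := by
  unfold trioDeficiency; rw [card_vadd_finset, card_vadd_finset, card_vadd_finset]

/-- A critical pair `|A + B| < |A| + |B|` gives a critical trio `(A, B, third A B)`.
[cite: BoothbyDevosMontejano2013, §3] -/
theorem trioDeficiency_third_pos_iff : 0 < trioDeficiency A B (third A B) ↔ #(A + B) < #A + #B := by
  rw [trioDeficiency_third]; omega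

/-- In a critical trio every pair is critical: `0 < δ(A,B,C) ⇒ |A + B| < |A| + |B|`.
[cite: BoothbyDevosMontejano2013, §3] -/
theorem IsTrio.card_add_lt (h : IsTrio A B C) (hδ : 0 < trioDeficiency A B C) :
    #(A + B) < #A + #B := by
  have := h.trioDeficiency_le; omega

/-- "`(B, C)` is critical since `B + C` is disjoint from `−A`": in a critical trio the pair of the
last two members is critical. [cite: BoothbyDevosMontejano2013, §3] -/
theorem IsTrio.card_add_lt_right (h : IsTrio A B C) (hδ : 0 < trioDeficiency A B C) :
    #(B + C) < #B + #C :=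
  h.rotate.card_add_lt (by rwa [trioDeficiency_rotate])

/-! ### Maximal trios -/

omit [Fintype G] in
/-- Unfolding lemma. [cite: BoothbyDevosMontejano2013, §3] -/
theorem isMaximalTrio_def : IsMaximalTrio A B C ↔ IsTrio A B C ∧ ∀ ⦃A' B' C' : Finset G⦄,
    A ⊆ A' → B ⊆ B' → C ⊆ C' → IsTrio A' B' C' → A' = A ∧ B' = B ∧ C' = C := Iff.rfl

omit [Fintype G] in
/-- A maximal trio is a trio. [cite: BoothbyDevosMontejano2013, §3] -/
theorem IsMaximalTrio.isTrio (h : IsMaximalTrio A B C) : IsTrio A B C := h.1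

omit [Fintype G] in
/-- Maximality is invariant under cyclic permutation. [cite: BoothbyDevosMontejano2013, §4] -/
theorem IsMaximalTrio.rotate (h : IsMaximalTrio A B C) : IsMaximalTrio B C A := by
  refine ⟨h.1.rotate, fun B' C' A' hB hC hA h' => ?_⟩
  obtain ⟨h1, h2, h3⟩ := h.2 hA hB hC h'.rotate.rotate
  exact ⟨h2, h3, h1⟩

omit [Fintype G] in
/-- Maximality is invariant under swapping. [cite: BoothbyDevosMontejano2013, §4] -/
theorem IsMaximalTrio.swap (h : IsMaximalTrio A B C) : IsMaximalTrio B A C := by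
  refine ⟨h.1.swap, fun B' A' C' hB hA hC h' => ?_⟩
  obtain ⟨h1, h2, h3⟩ := h.2 hA hB hC h'.swap
  exact ⟨h2, h1, h3⟩

omit [Fintype G] in
/-- Maximality is invariant under swapping the last two. [cite: BoothbyDevosMontejano2013, §4] -/
theorem IsMaximalTrio.swap_right (h : IsMaximalTrio A B C) : IsMaximalTrio A C B :=
  h.swap.rotate

omit [Fintype G] in
/-- Maximality is invariant under the translation `(A, g + B, −g + C)`. [cite: BoothbyDevosMontejano2013, §4] -/
theorem IsMaximalTrio.translate_right (h : IsMaximalTrio A B C) (g : G) :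
    IsMaximalTrio A (g +ᵥ B) (-g +ᵥ C) := by
  refine ⟨h.1.translate_right g, fun A' B' C' hA hB hC h' => ?_⟩
  have h'' : IsTrio A' (-g +ᵥ B') (g +ᵥ C') := by
    have := h'.translate_right (-g); rwa [neg_neg] at this
  have hB' : B ⊆ -g +ᵥ B' := by
    intro b hb
    have : g +ᵥ b ∈ B' := hB ((vadd_mem_vadd_finset_iff g).2 hb)
    rw [← neg_vadd_mem_iff, neg_neg]; exact this
  have hC' : C ⊆ g +ᵥ C' := by
    intro c hc
    have : -g +ᵥ c ∈ C' := hC ((vadd_mem_vadd_finset_iff (-g)).2 hc)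
    rw [← neg_vadd_mem_iff]; exact this
  obtain ⟨h1, h2, h3⟩ := h.2 hA hB' hC' h''
  refine ⟨h1, ?_, ?_⟩
  · rw [← h2, ← add_vadd, add_neg_cancel, zero_vadd]
  · rw [← h3, ← add_vadd, neg_add_cancel, zero_vadd]

/-- "`(A,B,C)` is maximal if and only if `C = third A B`, `B = third A C` and `A = third B C`."
[cite: BoothbyDevosMontejano2013, §3] -/
theorem isMaximalTrio_iff :
    IsMaximalTrio A B C ↔ C = third A B ∧ B = third A C ∧ A = third B C := by
  constructor
  · intro h
    have key : ∀ {A B C : Finset G}, IsMaximalTrio A B C → C = third A B := fun {A B C} h =>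
      ((h.2 Subset.rfl Subset.rfl (isTrio_iff_subset_third.1 h.1) (isTrio_third A B)).2.2).symm
    exact ⟨key h, key h.swap_right, key h.rotate⟩
  · rintro ⟨hC, hB, hA⟩
    refine ⟨hC ▸ isTrio_third A B, fun A' B' C' hA' hB' hC' h' => ?_⟩
    have eC : C' = C := Subset.antisymm
      (((isTrio_iff_subset_third.1 h').trans (third_mono hA' hB')).trans (subset_of_eq hC.symm)) hC'
    have eB : B' = B := Subset.antisymm
      (((isTrio_iff_subset_third.1 h'.swap_right).trans (third_mono hA' hC')).trans
        (subset_of_eq hB.symm)) hB'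
    have eA : A' = A := Subset.antisymm
      (((isTrio_iff_subset_third.1 h'.rotate).trans (third_mono hB' hC')).trans
        (subset_of_eq hA.symm)) hA'
    exact ⟨eA, eB, eC⟩

/-- In particular a maximal trio has `C = third A B`. [cite: BoothbyDevosMontejano2013, §3] -/
theorem IsMaximalTrio.eq_third (h : IsMaximalTrio A B C) : C = third A B :=
  (isMaximalTrio_iff.1 h).1

/-- Every trio has a maximal supertrio. [cite: BoothbyDevosMontejano2013, §3] -/
theorem IsTrio.exists_maximal (h : IsTrio A B C) :
    ∃ A' B' C' : Finset G, A ⊆ A' ∧ B ⊆ B' ∧ C ⊆ C' ∧ IsMaximalTrio A' B' C' := by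
  classical
  -- maximise `#A' + #B' + #C'` over supertrios
  let S : Finset (Finset G × Finset G × Finset G) :=
    (univ : Finset (Finset G × Finset G × Finset G)).filter
      fun T => A ⊆ T.1 ∧ B ⊆ T.2.1 ∧ C ⊆ T.2.2 ∧ IsTrio T.1 T.2.1 T.2.2
  have hne : S.Nonempty := ⟨(A, B, C), by simp [S, h]⟩
  obtain ⟨T, hT, hmax⟩ := exists_max_image S (fun T => #T.1 + #T.2.1 + #T.2.2) hne
  simp only [S, mem_filter, mem_univ, true_and] at hT
  obtain ⟨hA, hB, hC, hT⟩ := hT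
  refine ⟨T.1, T.2.1, T.2.2, hA, hB, hC, hT, fun A' B' C' hA' hB' hC' h' => ?_⟩
  have hle := hmax (A', B', C') (by simp [S, hA.trans hA', hB.trans hB', hC.trans hC', h'])
  simp only at hle
  have h1 := card_le_card hA'; have h2 := card_le_card hB'; have h3 := card_le_card hC'
  exact ⟨(eq_of_subset_of_card_le hA' (by omega)).symm, (eq_of_subset_of_card_le hB' (by omega)).symm,
    (eq_of_subset_of_card_le hC' (by omega)).symm⟩

/-- A critical trio with nonempty members: then `A`, `B`, `C` are all PROPER subsets of `G`
(`A + B + C ≠ G`). [cite: BoothbyDevosMontejano2013, §2] -/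
theorem IsTrio.add_ne_univ (h : IsTrio A B C) (hC : C.Nonempty) : A + B ≠ univ := by
  intro hu
  obtain ⟨c, hc⟩ := hC
  exact mem_third.1 (isTrio_iff_subset_third.1 h hc) (hu ▸ mem_univ _)

end Trio


/-! ## §2 and Theorem 3.5. Pure pairs; Kneser's theorem for trios -/

/-- A pair `(A, B)` is PURE if `stab A = stab B = stab (A + B)` (§2). [cite: BoothbyDevosMontejano2013, §2] -/
def IsPurePair (A B : Finset G) : Prop :=
  A.addStab = (A + B).addStab ∧ B.addStab = (A + B).addStab

section Pure

variable {A B C : Finset G}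

/-- Unfolding lemma. [cite: BoothbyDevosMontejano2013, §2] -/
theorem isPurePair_iff : IsPurePair A B ↔ A.addStab = (A + B).addStab ∧ B.addStab = (A + B).addStab :=
  Iff.rfl

/-- Purity is symmetric. [cite: BoothbyDevosMontejano2013, §2] -/
theorem IsPurePair.symm (h : IsPurePair A B) : IsPurePair B A := by
  unfold IsPurePair at h ⊢; rw [add_comm B A]; exact ⟨h.2, h.1⟩

/-- The members of a pure pair are stable under the stabilizer of the sum: `A + stab(A+B) = A`.
[cite: BoothbyDevosMontejano2013, §2] -/
theorem IsPurePair.add_addStab_left (h : IsPurePair A B) : A + (A + B).addStab = A := by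
  rw [← h.1]; exact add_addStab A

/-- Likewise `B + stab(A+B) = B`. [cite: BoothbyDevosMontejano2013, §2] -/
theorem IsPurePair.add_addStab_right (h : IsPurePair A B) : B + (A + B).addStab = B := by
  rw [← h.2]; exact add_addStab B

/-- `(A + H) + (B + H) = A + B` for `H = stab(A + B)`. [cite: BoothbyDevosMontejano2013, Obs 2.1] -/
theorem add_addStab_add_add_addStab (A B : Finset G) :
    (A + (A + B).addStab) + (B + (A + B).addStab) = A + B := by
  rw [add_add_add_comm, addStab_add_addStab, add_addStab]

/-- **Observation 2.1.**  "If `G_{A+B} = H`, then `(A + H, B + H)` is pure."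
[cite: BoothbyDevosMontejano2013, Obs 2.1] -/
theorem isPurePair_add_addStab (hA : A.Nonempty) (hB : B.Nonempty) :
    IsPurePair (A + (A + B).addStab) (B + (A + B).addStab) := by
  have hH : (A + B).addStab.Nonempty := (hA.add hB).addStab
  have key : ∀ {A B : Finset G}, A.Nonempty → B.Nonempty →
      (A + (A + B).addStab).addStab = (A + B).addStab := by
    intro A B hA hB
    have hH : (A + B).addStab.Nonempty := (hA.add hB).addStab
    refine Subset.antisymm ?_ ?_
    · have := subset_addStab_add_left (s := A + (A + B).addStab) (hB.add hH)
      rwa [add_addStab_add_add_addStab] at this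
    · have := subset_addStab_add_right hA (t := (A + B).addStab)
      rwa [addStab_idem] at this
  refine ⟨?_, ?_⟩
  · rw [add_addStab_add_add_addStab]; exact key hA hB
  · rw [add_addStab_add_add_addStab, add_comm A B]
    have := key hB hA
    rwa [add_comm B A] at this ⊢

/-- **Every maximal trio with nonempty first two members is pure in its first two members**: for
`H = stab(A + B)` the triple `(A + H, B, C)` is again a trio, so maximality forces `A + H = A`, i.e.
`stab A = H`; likewise for `B` (the argument of Prop 3.4 / Thm 3.5).
[cite: BoothbyDevosMontejano2013, Thm 3.5 (proof)] -/
theorem IsMaximalTrio.isPurePair (h : IsMaximalTrio A B C) (hA : A.Nonempty) (hB : B.Nonempty) :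
    IsPurePair A B := by
  have hH : IsSubgroupCarrier (A + B).addStab := IsSubgroupCarrier.of_addStab (hA.add hB)
  have key : ∀ {A B : Finset G}, IsMaximalTrio A B C → A.Nonempty → B.Nonempty →
      A.addStab = (A + B).addStab := by
    intro A B h hA hB
    have hH : IsSubgroupCarrier (A + B).addStab := IsSubgroupCarrier.of_addStab (hA.add hB)
    have htrio : IsTrio (A + (A + B).addStab) B C := by
      have h1 := h.1
      unfold IsTrio at h1 ⊢
      rwa [add_right_comm A, add_addStab]
    have hfix : A + (A + B).addStab = A := (h.2 (hH.subset_add A) Subset.rfl Subset.rfl htrio).1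
    exact Subset.antisymm (subset_addStab_add_left hB)
      ((hH.add_eq_self_iff_subset_addStab hA).1 hfix)
  refine ⟨key h hA hB, ?_⟩
  rw [add_comm A B]; exact key h.swap hB hA

/-- **Theorem 3.5 (Kneser, version II), stabilizer part.**  "If `(A,B,C)` is a maximal critical
trio in `G`, then `G_A = G_B = G_C`" — for nonempty members (criticality is not needed for this
part). [cite: BoothbyDevosMontejano2013, Thm 3.5] -/
theorem IsMaximalTrio.addStab_eq (h : IsMaximalTrio A B C) (hA : A.Nonempty) (hB : B.Nonempty)
    (hC : C.Nonempty) : A.addStab = B.addStab ∧ B.addStab = C.addStab := by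
  have h1 := h.isPurePair hA hB
  have h2 := h.rotate.isPurePair hB hC
  exact ⟨h1.1.trans h1.2.symm, h2.1.trans h2.2.symm⟩

variable [Fintype G]

/-- **Theorem 3.5 (Kneser, version II), deficiency part.**  "If `(A,B,C)` is a maximal critical trio
in `G`, then … `δ(A,B,C) = |G_A|`" (here written with `H = stab(A + B) = stab A`); the members are
assumed nonempty (a "nontrivial" trio).  Proof as printed: `(A,B)` is pure and critical, and
Kneser's theorem holds with equality for critical pairs. [cite: BoothbyDevosMontejano2013, Thm 3.5] -/
theorem IsMaximalTrio.trioDeficiency_eq_card_addStab (h : IsMaximalTrio A B C) (hA : A.Nonempty)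
    (hB : B.Nonempty) (hδ : 0 < trioDeficiency A B C) :
    trioDeficiency A B C = #(A + B).addStab := by
  have hP := h.isPurePair hA hB
  have hcrit : #(A + B) < #A + #B := h.isTrio.card_add_lt hδ
  have hk := kneser_eq_of_card_add_lt hA hB hcrit
  rw [hP.add_addStab_left, hP.add_addStab_right] at hk
  rw [h.eq_third, trioDeficiency_third]
  omega

/-- The same with `stab A`. [cite: BoothbyDevosMontejano2013, Thm 3.5] -/
theorem IsMaximalTrio.trioDeficiency_eq_card_addStab' (h : IsMaximalTrio A B C) (hA : A.Nonempty)
    (hB : B.Nonempty) (hδ : 0 < trioDeficiency A B C) :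
    trioDeficiency A B C = #A.addStab := by
  rw [h.trioDeficiency_eq_card_addStab hA hB hδ, (h.isPurePair hA hB).1]

omit [Fintype G] in
/-- **Proposition 2.2.**  "For every nontrivial pair of finite subsets `(A,B)` of `G` the following
are equivalent. (1) The pair `(A,B)` is critical. (2) There exists a pure critical superpair
`(A*,B*) ⊇ (A,B)` for which `|A* ∖ A| + |B* ∖ B| < |G_{A*+B*}|`."  Proof as printed:
`(A + H, B + H)` with `H = stab(A+B)` for (1) ⇒ (2); for (2) ⇒ (1) every element of `A* + B*`
has `|H|` representations `(a + h) + (b − h)`, too many to be all destroyed.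
[cite: BoothbyDevosMontejano2013, Prop 2.2] -/
theorem critical_iff_exists_pure_superpair (hA : A.Nonempty) (hB : B.Nonempty) :
    #(A + B) < #A + #B ↔ ∃ A' B' : Finset G, A ⊆ A' ∧ B ⊆ B' ∧ IsPurePair A' B' ∧
      #(A' + B') < #A' + #B' ∧ #(A' \ A) + #(B' \ B) < #(A' + B').addStab := by
  constructor
  · intro hcrit
    have hk := kneser_eq_of_card_add_lt hA hB hcrit
    set H := (A + B).addStab with hHdef
    have hH : IsSubgroupCarrier H := IsSubgroupCarrier.of_addStab (hA.add hB)
    refine ⟨A + H, B + H, hH.subset_add A, hH.subset_add B, isPurePair_add_addStab hA hB, ?_, ?_⟩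
    · rw [add_addStab_add_add_addStab]
      have h1 := card_le_card (hH.subset_add A)
      have h2 := card_le_card (hH.subset_add B)
      omega
    · rw [add_addStab_add_add_addStab, card_sdiff_of_subset (hH.subset_add A),
        card_sdiff_of_subset (hH.subset_add B), ← hHdef]
      have h1 := card_le_card (hH.subset_add A)
      have h2 := card_le_card (hH.subset_add B)
      omega
  · rintro ⟨A', B', hAA', hBB', hP, hcrit', hsmall⟩
    have hA' : A'.Nonempty := hA.mono hAA'
    have hB' : B'.Nonempty := hB.mono hBB'
    set H := (A' + B').addStab with hHdef
    have hH : IsSubgroupCarrier H := IsSubgroupCarrier.of_addStab (hA'.add hB')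
    -- `A + B = A' + B'`
    have hsum : A + B = A' + B' := by
      refine Subset.antisymm (add_subset_add hAA' hBB') fun z hz => ?_
      by_contra hzAB
      obtain ⟨a, ha, b, hb, rfl⟩ := mem_add.1 hz
      -- every `h ∈ H` gives a representation `(a + h) + (b - h)`, one coordinate of which is missing
      have hcover : H ⊆ (H.filter fun h => a + h ∉ A) ∪ (H.filter fun h => b - h ∉ B) := by
        intro h hh
        rw [mem_union, mem_filter, mem_filter]
        by_contra hcon
        have h1 : a + h ∈ A := by
          by_contra h1; exact hcon (Or.inl ⟨hh, h1⟩)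
        have h2 : b - h ∈ B := by
          by_contra h2; exact hcon (Or.inr ⟨hh, h2⟩)
        exact hzAB (mem_add.2 ⟨a + h, h1, b - h, h2, by abel⟩)
      have hinjA : #(H.filter fun h => a + h ∉ A) ≤ #(A' \ A) := by
        refine card_le_card_of_injOn (fun h => a + h) (fun h hh => ?_) (fun x _ y _ hxy => by
          simpa using hxy)
        rw [mem_coe, mem_filter] at hh
        rw [mem_coe, mem_sdiff]
        refine ⟨?_, hh.2⟩
        have hhA : h ∈ A'.addStab := by rw [hP.1, ← hHdef]; exact hh.1
        have := (vadd_mem_vadd_finset_iff h).2 ha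
        rwa [(mem_addStab hA').1 hhA, vadd_eq_add, add_comm] at this
      have hinjB : #(H.filter fun h => b - h ∉ B) ≤ #(B' \ B) := by
        refine card_le_card_of_injOn (fun h => b - h) (fun h hh => ?_) (fun x _ y _ hxy => by
          simpa using hxy)
        rw [mem_coe, mem_filter] at hh
        rw [mem_coe, mem_sdiff]
        refine ⟨?_, hh.2⟩
        have hhB : -h ∈ B'.addStab := by rw [hP.2, ← hHdef]; exact hH.neg_mem hh.1
        have := (vadd_mem_vadd_finset_iff (-h)).2 hb
        rwa [(mem_addStab hB').1 hhB, vadd_eq_add, neg_add_eq_sub] at this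
      have := (card_le_card hcover).trans (card_union_le _ _)
      omega
    have hk := kneser_eq_of_card_add_lt hA' hB' hcrit'
    rw [hP.add_addStab_left, hP.add_addStab_right, ← hHdef] at hk
    rw [card_sdiff_of_subset hAA', card_sdiff_of_subset hBB'] at hsmall
    have h1 := card_le_card hAA'
    have h2 := card_le_card hBB'
    rw [hsum]
    omega

/-- The step of Proposition 3.4: for a pure critical pair `(A,B)`, no `A* ⊋ A` keeps
`(A*, B, third A B)` a trio ("then `A* + B = A + B`, but then `|A* + B| = |A| + |B| − |H| <
|A*| + |B| − |H|` contradicts Kneser's Theorem"). [cite: BoothbyDevosMontejano2013, Prop 3.4 (proof)] -/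
theorem IsPurePair.eq_of_isTrio_third (hP : IsPurePair A B) (hA : A.Nonempty) (hB : B.Nonempty)
    (hcrit : #(A + B) < #A + #B) {A' : Finset G} (hAA' : A ⊆ A') (h' : IsTrio A' B (third A B)) :
    A' = A := by
  have hA' : A'.Nonempty := hA.mono hAA'
  have hsum : A' + B = A + B := by
    refine Subset.antisymm (fun x hx => ?_) (add_subset_add_right hAA')
    have hsub := isTrio_iff_subset_third.1 h'
    by_contra hxAB
    have : -x ∈ third A B := mem_third.2 (by rwa [neg_neg])
    exact mem_third.1 (hsub this) (by rwa [neg_neg])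
  have hk := kneser_eq_of_card_add_lt hA hB hcrit
  rw [hP.add_addStab_left, hP.add_addStab_right] at hk
  have hk' := add_kneser A' B
  rw [hsum, hP.add_addStab_right] at hk'
  have h1 : #A' ≤ #(A' + (A + B).addStab) := card_le_card_add_right (hA.add hB).addStab
  exact (eq_of_subset_of_card_le hAA' (by omega)).symm

/-- **Proposition 3.4.**  "Let `A,B,C ⊆ G` be nonempty and assume `A,B` are finite. Then the
following are equivalent. (1) `(A,B)` is a pure critical pair and `C = third A B`. (2) `(A,B,C)` is
a maximal critical trio." [cite: BoothbyDevosMontejano2013, Prop 3.4] -/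
theorem purePair_critical_iff_maximalTrio (hA : A.Nonempty) (hB : B.Nonempty) :
    (IsPurePair A B ∧ #(A + B) < #A + #B ∧ C = third A B) ↔
      (IsMaximalTrio A B C ∧ 0 < trioDeficiency A B C) := by
  constructor
  · rintro ⟨hP, hcrit, rfl⟩
    refine ⟨⟨isTrio_third A B, fun A' B' C' hAA' hBB' hCC' h' => ?_⟩,
      trioDeficiency_third_pos_iff.2 hcrit⟩
    have eC : C' = third A B :=
      Subset.antisymm ((isTrio_iff_subset_third.1 h').trans (third_mono hAA' hBB')) hCC'
    subst eC
    have eA : A' = A := hP.eq_of_isTrio_third hA hB hcrit hAA' (h'.mono Subset.rfl hBB' Subset.rfl)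
    have eB : B' = B := by
      refine hP.symm.eq_of_isTrio_third hB hA (by rw [add_comm B A]; omega) hBB' ?_
      rw [third_comm B A]
      exact (h'.mono hAA' Subset.rfl Subset.rfl).swap
    exact ⟨eA, eB, rfl⟩
  · rintro ⟨h, hδ⟩
    exact ⟨h.isPurePair hA hB, h.isTrio.card_add_lt hδ, h.eq_third⟩

end Pure


/-! ## §5. Incomplete closure: Lemma 5.1 (relative form), Lemma 5.2, beat stability -/

/-- "`[A]` is an `H`-coset" (the paper's closure `[A]` = the unique minimal subgroup-coset
containing `A`): `A` lies in a coset of the subgroup carrier `H`, and in a coset of no proper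
subgroup carrier `K ⊊ H`. [cite: BoothbyDevosMontejano2013, §4] -/
def ClosureIs (H A : Finset G) : Prop :=
  (∃ a : G, A ⊆ a +ᵥ H) ∧
    ∀ ⦃K : Finset G⦄, IsSubgroupCarrier K → K ⊆ H → (∃ a : G, A ⊆ a +ᵥ K) → K = H

section Closure

variable {H K A B C : Finset G}

/-- Unfolding lemma. [cite: BoothbyDevosMontejano2013, §4] -/
theorem closureIs_iff : ClosureIs H A ↔ (∃ a : G, A ⊆ a +ᵥ H) ∧
    ∀ ⦃K : Finset G⦄, IsSubgroupCarrier K → K ⊆ H → (∃ a : G, A ⊆ a +ᵥ K) → K = H := Iff.rfl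

/-- If `A` meets the coset `a₀ +ᵥ H` and lies in some `H`-coset, it lies in `a₀ +ᵥ H`.
[cite: BoothbyDevosMontejano2013, §4] -/
theorem IsSubgroupCarrier.subset_coset_of_mem (hH : IsSubgroupCarrier H) {a a₀ : G}
    (hA : A ⊆ a +ᵥ H) (ha₀ : a₀ ∈ A) : A ⊆ a₀ +ᵥ H := by
  rw [hH.coset_eq_of_mem (hA ha₀)]; exact hA

/-- `A ⊆ a₀ + H` and `B ⊆ b + H` give `A + B ⊆ (a₀ + b) + H`. [cite: BoothbyDevosMontejano2013, §5] -/
theorem IsSubgroupCarrier.add_subset_coset (hH : IsSubgroupCarrier H) {a₀ b : G}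
    (hA : A ⊆ a₀ +ᵥ H) (hB : B ⊆ b +ᵥ H) : A + B ⊆ (a₀ + b) +ᵥ H := by
  intro x hx
  obtain ⟨a, ha, b', hb', rfl⟩ := mem_add.1 hx
  rw [hH.mem_coset_iff]
  have h1 := (hH.mem_coset_iff).1 (hA ha)
  have h2 := (hH.mem_coset_iff).1 (hB hb')
  have : a + b' - (a₀ + b) = (a - a₀) + (b' - b) := by abel
  rw [this]; exact hH.add_mem h1 h2

/-- A nonempty `H`-stable subset of one coset is the coset. [cite: BoothbyDevosMontejano2013, §5] -/
theorem IsSubgroupCarrier.eq_coset_of_stable (hH : IsSubgroupCarrier H) {P : Finset G} {c : G}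
    (hP : P + H = P) (hPne : P.Nonempty) (hsub : P ⊆ c +ᵥ H) : P = c +ᵥ H := by
  obtain ⟨p, hp⟩ := hPne
  refine Subset.antisymm hsub ?_
  rw [← hH.coset_eq_of_mem (hsub hp)]
  exact hH.coset_subset_of_stable hP hp

/-- `A + (b + H) = (a₀ + b) + H` when `∅ ≠ A ⊆ a₀ + H`. [cite: BoothbyDevosMontejano2013, §5] -/
theorem IsSubgroupCarrier.add_coset_eq (hH : IsSubgroupCarrier H) {a₀ b : G} (hA : A ⊆ a₀ +ᵥ H)
    (hAne : A.Nonempty) : A + (b +ᵥ H) = (a₀ + b) +ᵥ H := by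
  refine hH.eq_coset_of_stable (by rw [add_assoc, hH.coset_add]) (hAne.add ⟨b, hH.mem_coset_self b⟩)
    (hH.add_subset_coset hA Subset.rfl)

/-- The closure of `B` is contained in every subgroup carrier a coset of which contains `B`
("for every set there is a unique minimal subgroup `H` for which `A` is contained in an `H`-coset").
[cite: BoothbyDevosMontejano2013, §4] -/
theorem ClosureIs.subset (hK : IsSubgroupCarrier K) (hcl : ClosureIs K B) (hH : IsSubgroupCarrier H)
    (hB : ∃ b : G, B ⊆ b +ᵥ H) : K ⊆ H := by
  have hKH : IsSubgroupCarrier (K ∩ H) := hK.inter hH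
  suffices h : K ∩ H = K by rw [← h]; exact inter_subset_right
  refine hcl.2 hKH inter_subset_left ?_
  rcases B.eq_empty_or_nonempty with rfl | ⟨b₀, hb₀⟩
  · exact ⟨0, empty_subset _⟩
  obtain ⟨a, ha⟩ := hcl.1
  obtain ⟨b, hb⟩ := hB
  refine ⟨b₀, fun x hx => ?_⟩
  rw [hKH.mem_coset_iff, mem_inter]
  exact ⟨(hK.mem_coset_iff).1 (hK.subset_coset_of_mem ha hb₀ hx),
    (hH.mem_coset_iff).1 (hH.subset_coset_of_mem hb hb₀ hx)⟩

variable [Fintype G]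

omit [DecidableEq G] in
/-- `univ` is a subgroup carrier. [cite: BoothbyDevosMontejano2013, §1] -/
theorem isSubgroupCarrier_univ : IsSubgroupCarrier (univ : Finset G) :=
  ⟨mem_univ _, fun _ _ _ _ => mem_univ _⟩

/-- Every set has a closure: some subgroup carrier `H` with `ClosureIs H A` (take one of least
cardinality among those a coset of which contains `A`). [cite: BoothbyDevosMontejano2013, §4] -/
theorem exists_closureIs (A : Finset G) : ∃ H : Finset G, IsSubgroupCarrier H ∧ ClosureIs H A := by
  classical
  let S : Finset (Finset G) :=
    (univ : Finset (Finset G)).filter fun K => IsSubgroupCarrier K ∧ ∃ a : G, A ⊆ a +ᵥ K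
  have hne : S.Nonempty := by
    refine ⟨univ, ?_⟩
    simp only [S, mem_filter, mem_univ, true_and]
    exact ⟨isSubgroupCarrier_univ, 0, by rw [vadd_finset_univ]; exact subset_univ _⟩
  obtain ⟨H, hH, hmin⟩ := exists_min_image S card hne
  simp only [S, mem_filter, mem_univ, true_and] at hH
  refine ⟨H, hH.1, hH.2, fun K hK hKH hAK => ?_⟩
  have hle := hmin K (by simp only [S, mem_filter, mem_univ, true_and]; exact ⟨hK, hAK⟩)
  exact eq_of_subset_of_card_le hKH hle

omit [Fintype G] in
/-- **Lemma 5.1, relative form** (Olson; "follows from Kneser's Theorem for abelian groups (as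
observed by Lev)").  Let `H` be a finite subgroup, `[A]` an `H`-coset, `B ≠ ∅`, and suppose `A + B`
is not `H`-stable (equivalently, when `B` lies in one `H`-coset: `A + B` is not the whole coset
`a + b + H`).  Then `|A + B| ≥ ½|A| + |B|`, stated as `|A| + 2|B| ≤ 2|A + B|`.  Proof as printed,
inside the coset: with `K = stab(A + B)`, Kneser gives `|A + B| ≥ |A + K| + |B + K| − |K|`; `A` is
not inside one `K`-coset (else `[A]` would lie in a coset of `K ∩ H ⊊ H`), so `|A + K| ≥ 2|K|` and
`|A + K| − |K| ≥ ½|A + K| ≥ ½|A|`.  (Absolute form, `[A] = G`: `olson_card_add'` in `Chowla.lean`.)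
[cite: BoothbyDevosMontejano2013, Lemma 5.1] -/
theorem card_add_two_mul_card_le_of_closureIs (hH : IsSubgroupCarrier H) (hcl : ClosureIs H A)
    (hB : B.Nonempty) (hne : A + B + H ≠ A + B) : #A + 2 * #B ≤ 2 * #(A + B) := by
  rcases A.eq_empty_or_nonempty with rfl | hA
  · simp at hne
  set S := A + B with hSdef
  have hS : S.Nonempty := hA.add hB
  have hK : IsSubgroupCarrier S.addStab := IsSubgroupCarrier.of_addStab hS
  obtain ⟨a, haA⟩ := hcl.1
  obtain ⟨a₁, ha₁⟩ := hA
  -- `A` is not contained in one coset of `K = stab S`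
  have hnot : ∃ a₂ ∈ A, a₂ - a₁ ∉ S.addStab := by
    by_contra hcon
    have hcon' : ∀ a₂ ∈ A, a₂ - a₁ ∈ S.addStab := by
      intro a₂ ha₂; by_contra h; exact hcon ⟨a₂, ha₂, h⟩
    have hKH : IsSubgroupCarrier (S.addStab ∩ H) := hK.inter hH
    have hsub : A ⊆ a₁ +ᵥ (S.addStab ∩ H) := by
      intro x hx
      rw [hKH.mem_coset_iff, mem_inter]
      exact ⟨hcon' x hx, (hH.mem_coset_iff).1 (hH.subset_coset_of_mem haA ha₁ hx)⟩
    have heq : S.addStab ∩ H = H := hcl.2 hKH inter_subset_right ⟨a₁, hsub⟩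
    have hHK : H ⊆ S.addStab := by rw [← heq]; exact inter_subset_left
    exact hne ((hH.add_eq_self_iff_subset_addStab hS).2 hHK)
  obtain ⟨a₂, ha₂, h12⟩ := hnot
  -- two disjoint `K`-cosets inside `A + K`
  have hdisj : Disjoint (a₁ +ᵥ S.addStab) (a₂ +ᵥ S.addStab) := by
    rcases Grynkiewicz.coset_eq_or_disjoint (S := S) a₁ a₂ with heq | hdis
    · exfalso; apply h12
      have : a₂ ∈ a₁ +ᵥ S.addStab := by rw [heq]; exact Grynkiewicz.mem_coset_self hS a₂
      exact Grynkiewicz.mem_coset_iff.1 this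
    · exact hdis
  have h2K : 2 * #S.addStab ≤ #(A + S.addStab) := by
    calc 2 * #S.addStab = #(a₁ +ᵥ S.addStab) + #(a₂ +ᵥ S.addStab) := by
          rw [card_vadd_finset, card_vadd_finset]; ring
      _ = #((a₁ +ᵥ S.addStab) ∪ (a₂ +ᵥ S.addStab)) := (card_union_of_disjoint hdisj).symm
      _ ≤ #(A + S.addStab) :=
          card_le_card (union_subset (coset_subset_add ha₁) (coset_subset_add ha₂))
  have hk := add_kneser A B
  rw [← hSdef] at hk
  have hAK : #A ≤ #(A + S.addStab) := card_le_card_add_right hS.addStab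
  have hBK : #B ≤ #(B + S.addStab) := card_le_card_add_right hS.addStab
  omega

omit [Fintype G] in
/-- The COSET DECOMPOSITION step of Lemma 5.2: for a critical pair `(A,B)` with `[A]` an `H`-coset,
at most one `H`-coset `R` of `B` has `A + (B ∩ R)` not `H`-stable ("there is at most one `i` for
which `A + B_i ≠ R_i`").  Here: some `b₀ ∈ B` such that every `b ∈ B` outside `b₀ + H` has
`A + (B ∩ (b + H))` `H`-stable. [cite: BoothbyDevosMontejano2013, Lemma 5.2 (proof)] -/
theorem exists_forall_piece_stable (hH : IsSubgroupCarrier H) (hcl : ClosureIs H A)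
    (hA : A.Nonempty) (hB : B.Nonempty) (hcrit : #(A + B) < #A + #B) :
    ∃ b₀ ∈ B, ∀ b ∈ B, b ∉ b₀ +ᵥ H →
      A + (B ∩ (b +ᵥ H)) + H = A + (B ∩ (b +ᵥ H)) := by
  obtain ⟨a, haA⟩ := hcl.1
  obtain ⟨a₀, ha₀⟩ := hA
  have hAa₀ : A ⊆ a₀ +ᵥ H := hH.subset_coset_of_mem haA ha₀
  -- the pieces
  have piece_sub : ∀ b : G, A + (B ∩ (b +ᵥ H)) ⊆ (a₀ + b) +ᵥ H := fun b =>
    hH.add_subset_coset hAa₀ inter_subset_right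
  by_cases hall : ∀ b ∈ B, A + (B ∩ (b +ᵥ H)) + H = A + (B ∩ (b +ᵥ H))
  · obtain ⟨b₀, hb₀⟩ := hB
    exact ⟨b₀, hb₀, fun b hb _ => hall b hb⟩
  push Not at hall
  obtain ⟨b₁, hb₁, hbad₁⟩ := hall
  refine ⟨b₁, hb₁, fun b₂ hb₂ hb₂₁ => ?_⟩
  by_contra hbad₂
  -- two bad cosets contradict criticality
  set B₁ := B ∩ (b₁ +ᵥ H) with hB₁
  set B₂ := B ∩ (b₂ +ᵥ H) with hB₂
  set B₃ := B \ ((b₁ +ᵥ H) ∪ (b₂ +ᵥ H)) with hB₃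
  have hB₁ne : B₁.Nonempty := ⟨b₁, mem_inter.2 ⟨hb₁, hH.mem_coset_self b₁⟩⟩
  have hB₂ne : B₂.Nonempty := ⟨b₂, mem_inter.2 ⟨hb₂, hH.mem_coset_self b₂⟩⟩
  have hcos : Disjoint (b₁ +ᵥ H) (b₂ +ᵥ H) := by
    rcases hH.coset_eq_or_disjoint b₁ b₂ with heq | hdis
    · exact (hb₂₁ (heq ▸ hH.mem_coset_self b₂)).elim
    · exact hdis
  -- the three pieces of `B` and of `A + B`
  have hd12 : Disjoint B₁ B₂ :=
    disjoint_of_subset_left inter_subset_right (disjoint_of_subset_right inter_subset_right hcos)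
  have hB12 : B ∩ ((b₁ +ᵥ H) ∪ (b₂ +ᵥ H)) = B₁ ∪ B₂ := by rw [inter_union_distrib_left]
  have hBcard : #B₁ + #B₂ + #B₃ = #B := by
    rw [← card_union_of_disjoint hd12, ← hB12, hB₃, add_comm, card_sdiff_add_card_inter]
  -- the pieces of `A + B` lie in distinct cosets
  have hD : Disjoint ((a₀ + b₁) +ᵥ H) ((a₀ + b₂) +ᵥ H) := by
    rcases hH.coset_eq_or_disjoint (a₀ + b₁) (a₀ + b₂) with heq | hdis
    · exfalso; apply hb₂₁
      have : a₀ + b₂ ∈ (a₀ + b₁) +ᵥ H := heq ▸ hH.mem_coset_self (a₀ + b₂)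
      rw [hH.mem_coset_iff] at this ⊢
      have e : a₀ + b₂ - (a₀ + b₁) = b₂ - b₁ := by abel
      rwa [e] at this
    · exact hdis
  have hP12 : Disjoint (A + B₁) (A + B₂) :=
    disjoint_of_subset_left (piece_sub b₁) (disjoint_of_subset_right (piece_sub b₂) hD)
  have hP3 : Disjoint (A + B₁ ∪ (A + B₂)) (A + B₃) := by
    rw [disjoint_union_left]
    have key : ∀ {b : G}, (∀ b₃ ∈ B₃, b₃ ∉ b +ᵥ H) →
        Disjoint (A + (B ∩ (b +ᵥ H))) (A + B₃) := by
      intro b hbex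
      refine disjoint_of_subset_left (piece_sub b) (disjoint_left.2 fun x hx hx3 => ?_)
      obtain ⟨a', ha', b₃, hb₃, rfl⟩ := mem_add.1 hx3
      have h1 : a' + b₃ - (a₀ + b) ∈ H := (hH.mem_coset_iff).1 hx
      have h2 : a' - a₀ ∈ H := (hH.mem_coset_iff).1 (hAa₀ ha')
      have h3 : b₃ - b ∈ H := by
        have := hH.sub_mem h1 h2
        have e : a' + b₃ - (a₀ + b) - (a' - a₀) = b₃ - b := by abel
        rwa [e] at this
      exact hbex b₃ hb₃ ((hH.mem_coset_iff).2 h3)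
    refine ⟨key fun b₃ hb₃ => ?_, key fun b₃ hb₃ => ?_⟩
    · rw [hB₃, mem_sdiff, mem_union, not_or] at hb₃; exact hb₃.2.1
    · rw [hB₃, mem_sdiff, mem_union, not_or] at hb₃; exact hb₃.2.2
  -- counting
  have hsub : A + B₁ ∪ (A + B₂) ∪ (A + B₃) ⊆ A + B :=
    union_subset (union_subset (add_subset_add_left inter_subset_left)
      (add_subset_add_left inter_subset_left)) (add_subset_add_left sdiff_subset)
  have hcardAB : #(A + B₁) + #(A + B₂) + #(A + B₃) ≤ #(A + B) := by
    calc #(A + B₁) + #(A + B₂) + #(A + B₃)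
        = #(A + B₁ ∪ (A + B₂) ∪ (A + B₃)) := by
          rw [card_union_of_disjoint hP3, card_union_of_disjoint hP12]
      _ ≤ #(A + B) := card_le_card hsub
  have h1 : #A + 2 * #B₁ ≤ 2 * #(A + B₁) :=
    card_add_two_mul_card_le_of_closureIs hH hcl hB₁ne hbad₁
  have h2 : #A + 2 * #B₂ ≤ 2 * #(A + B₂) :=
    card_add_two_mul_card_le_of_closureIs hH hcl hB₂ne hbad₂
  have h3 : #B₃ ≤ #(A + B₃) := card_le_card_add_left ⟨a₀, ha₀⟩
  omega

omit [Fintype G] in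
/-- **Lemma 5.2, first part.**  "Let `(A,B)` be a critical pair of finite sets and assume
`[A] ∈ G/H` for some `H < G`.  Then `A + B` is `H`-quasistable" — there is an `H`-coset `R` with
`(A + B) ∖ R` `H`-stable. [cite: BoothbyDevosMontejano2013, Lemma 5.2] -/
theorem exists_quasistable_of_critical (hH : IsSubgroupCarrier H) (hcl : ClosureIs H A)
    (hA : A.Nonempty) (hB : B.Nonempty) (hcrit : #(A + B) < #A + #B) :
    ∃ r : G, (A + B) \ (r +ᵥ H) + H = (A + B) \ (r +ᵥ H) := by
  obtain ⟨a, haA⟩ := hcl.1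
  obtain ⟨a₀, ha₀⟩ := id hA
  have hAa₀ : A ⊆ a₀ +ᵥ H := hH.subset_coset_of_mem haA ha₀
  obtain ⟨b₀, hb₀, hgood⟩ := exists_forall_piece_stable hH hcl hA hB hcrit
  refine ⟨a₀ + b₀, Subset.antisymm ?_ (hH.subset_add _)⟩
  intro y hy
  obtain ⟨x, hx, h, hh, rfl⟩ := mem_add.1 hy
  rw [mem_sdiff] at hx ⊢
  obtain ⟨hxAB, hxR⟩ := hx
  obtain ⟨a', ha', b, hb, rfl⟩ := mem_add.1 hxAB
  have hbR : b ∉ b₀ +ᵥ H := by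
    intro hbR
    apply hxR
    exact hH.add_subset_coset hAa₀ (singleton_subset_iff.2 hbR)
      (add_mem_add ha' (mem_singleton_self b))
  have hstab := hgood b hb hbR
  have hxP : a' + b ∈ A + (B ∩ (b +ᵥ H)) :=
    add_mem_add ha' (mem_inter.2 ⟨hb, hH.mem_coset_self b⟩)
  constructor
  · have : a' + b + h ∈ A + (B ∩ (b +ᵥ H)) := by
      rw [← hstab]; exact add_mem_add hxP hh
    exact add_subset_add_left inter_subset_left this
  · intro hmem
    apply hxR
    rw [hH.mem_coset_iff] at hmem ⊢
    have := hH.sub_mem hmem hh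
    have e : a' + b + h - (a₀ + b₀) - h = a' + b - (a₀ + b₀) := by abel
    rwa [e] at this

omit [Fintype G] in
/-- **Lemma 5.2, second part.**  "Furthermore, if `H` is finite, then `δ(H,B) ≥ δ(A,B)`", i.e.
`|H| + |B| − |H + B| ≥ |A| + |B| − |A + B|`, stated as `|A| + |H + B| ≤ |A + B| + |H|`.  Proof as
printed: all cosets of `B` but one contribute a full `H`-coset to `A + B`, the last at least `|A|`.
[cite: BoothbyDevosMontejano2013, Lemma 5.2] -/
theorem card_add_card_add_le_of_critical (hH : IsSubgroupCarrier H) (hcl : ClosureIs H A)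
    (hA : A.Nonempty) (hB : B.Nonempty) (hcrit : #(A + B) < #A + #B) :
    #A + #(H + B) ≤ #(A + B) + #H := by
  obtain ⟨a, haA⟩ := hcl.1
  obtain ⟨a₀, ha₀⟩ := id hA
  have hAa₀ : A ⊆ a₀ +ᵥ H := hH.subset_coset_of_mem haA ha₀
  obtain ⟨b₀, hb₀, hgood⟩ := exists_forall_piece_stable hH hcl hA hB hcrit
  -- `T = B + H` splits into the coset `C₀ = b₀ + H` and `T' = (B \ C₀) + H`
  set C₀ := b₀ +ᵥ H with hC₀
  set B₀ := B ∩ C₀ with hB₀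
  set B' := B \ C₀ with hB'
  have hT : H + B = C₀ ∪ (B' + H) := by
    rw [add_comm H B]
    apply Subset.antisymm
    · intro x hx
      obtain ⟨b, hb, h, hh, rfl⟩ := mem_add.1 hx
      by_cases hbC : b ∈ C₀
      · exact mem_union_left _ (by
          rw [hC₀, hH.mem_coset_iff] at hbC ⊢
          have e : b + h - b₀ = (b - b₀) + h := by abel
          rw [e]; exact hH.add_mem hbC hh)
      · exact mem_union_right _ (add_mem_add (mem_sdiff.2 ⟨hb, hbC⟩) hh)
    · refine union_subset ?_ (add_subset_add_right sdiff_subset)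
      rw [hC₀]
      intro x hx
      have := (hH.mem_coset_iff).1 hx
      exact mem_add.2 ⟨b₀, hb₀, x - b₀, this, by abel⟩
  have hdisjT : Disjoint C₀ (B' + H) := by
    refine disjoint_left.2 fun x hx hx' => ?_
    obtain ⟨b, hb, h, hh, rfl⟩ := mem_add.1 hx'
    rw [hB', mem_sdiff] at hb
    apply hb.2
    rw [hC₀, hH.mem_coset_iff] at hx ⊢
    have := hH.sub_mem hx hh
    have e : b + h - b₀ - h = b - b₀ := by abel
    rwa [e] at this
  -- inside `A + B`: the piece over `C₀` has `≥ |A|` elements, the rest is `a₀ + (B' + H)`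
  have hsub1 : A + B₀ ⊆ A + B := add_subset_add_left inter_subset_left
  have hsub2 : a₀ +ᵥ (B' + H) ⊆ A + B := by
    intro x hx
    rw [← neg_vadd_mem_iff, vadd_eq_add] at hx
    obtain ⟨b, hb, h, hh, hx⟩ := mem_add.1 hx
    have hbB : b ∈ B := (mem_sdiff.1 hb).1
    have hbC : b ∉ b₀ +ᵥ H := (mem_sdiff.1 hb).2
    have hstab := hgood b hbB hbC
    have hP : a₀ + b ∈ A + (B ∩ (b +ᵥ H)) :=
      add_mem_add ha₀ (mem_inter.2 ⟨hbB, hH.mem_coset_self b⟩)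
    have : a₀ + b + h ∈ A + (B ∩ (b +ᵥ H)) := by rw [← hstab]; exact add_mem_add hP hh
    have e : a₀ + b + h = x := by rw [add_assoc, hx, ← add_assoc, add_neg_cancel, zero_add]
    rw [e] at this
    exact add_subset_add_left inter_subset_left this
  have hdisj : Disjoint (A + B₀) (a₀ +ᵥ (B' + H)) := by
    refine disjoint_left.2 fun x hx hx' => ?_
    have hx1 : x ∈ (a₀ + b₀) +ᵥ H := hH.add_subset_coset hAa₀ inter_subset_right hx
    rw [← neg_vadd_mem_iff, vadd_eq_add] at hx'
    obtain ⟨b, hb, h, hh, hx2⟩ := mem_add.1 hx'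
    apply (mem_sdiff.1 hb).2
    rw [hC₀, hH.mem_coset_iff]
    rw [hH.mem_coset_iff] at hx1
    have hx3 : x = a₀ + (b + h) := by rw [hx2, ← add_assoc, add_neg_cancel, zero_add]
    have e : b - b₀ = x - (a₀ + b₀) - h := by rw [hx3]; abel
    rw [e]; exact hH.sub_mem hx1 hh
  have hcard : #(A + B₀) + #(B' + H) ≤ #(A + B) := by
    calc #(A + B₀) + #(B' + H) = #(A + B₀) + #(a₀ +ᵥ (B' + H)) := by rw [card_vadd_finset]
      _ = #(A + B₀ ∪ (a₀ +ᵥ (B' + H))) := (card_union_of_disjoint hdisj).symm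
      _ ≤ #(A + B) := card_le_card (union_subset hsub1 hsub2)
  have hB₀ne : B₀.Nonempty := ⟨b₀, mem_inter.2 ⟨hb₀, hH.mem_coset_self b₀⟩⟩
  have hAB₀ : #A ≤ #(A + B₀) := card_le_card_add_right hB₀ne
  have hTcard : #(H + B) = #H + #(B' + H) := by
    rw [hT, card_union_of_disjoint hdisjT, hC₀, card_vadd_finset]
  omega

end Closure


section Beat

variable [Fintype G] {H A B C : Finset G}

/-- **Lemma 5.3 (Beat Stability)**, in normal position.  "If `(A,B,C)` is a maximal critical trio
and `[A] ∈ G/H` for some `H < G`, then `(A,B,C)` is either a pure or impure beat."  Here the trio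
has nonempty members and `A ⊆ H = ` the subgroup of which `[A]` is a coset (the general case is
this one after the translation `(A − a, B + a, C)`).  Conclusion: EITHER `A = H` and
`stab B = stab C = H`, `C = third A B` (a PURE BEAT relative to `H`, Definition 4.1), OR for the
translated ("similar") trio `(A, g + B, −g + C)` with the explicit `g = −b₀` of the proof:
`(g + B) ∖ H` is `H`-stable, `(−g + C) ∖ H = third A (g + B) ∖ H`, and both `g + B` and `−g + C`
meet `H` (an IMPURE BEAT relative to `H`, Definition 4.3, with continuation
`(A, (g + B) ∩ H, (−g + C) ∩ H)`).  Proof as printed: Lemma 5.2 makes `A + B` `H`-quasistable; if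
it is `H`-stable, maximality gives `A = H` and `H = stab B = stab C`; otherwise translate the one
incomplete coset to `H` and read off Definition 4.3 from maximality.
[cite: BoothbyDevosMontejano2013, Lemma 5.3] -/
theorem IsMaximalTrio.pureBeat_or_impureBeat (h : IsMaximalTrio A B C)
    (hδ : 0 < trioDeficiency A B C) (hA : A.Nonempty) (hB : B.Nonempty) (hC : C.Nonempty)
    (hH : IsSubgroupCarrier H) (hcl : ClosureIs H A) (hAH : A ⊆ H) :
    (A = H ∧ B.addStab = H ∧ C.addStab = H ∧ C = third A B) ∨
    ∃ g : G, (g +ᵥ B) \ H + H = (g +ᵥ B) \ H ∧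
      (-g +ᵥ C) \ H = third A (g +ᵥ B) \ H ∧
      ((g +ᵥ B) ∩ H).Nonempty ∧ ((-g +ᵥ C) ∩ H).Nonempty := by
  have hAB : C = third A B := h.eq_third
  have hcrit : #(A + B) < #A + #B := h.isTrio.card_add_lt hδ
  have hA0 : A ⊆ (0 : G) +ᵥ H := by rwa [zero_vadd]
  obtain ⟨b₀, hb₀, hgood⟩ := exists_forall_piece_stable hH hcl hA hB hcrit
  by_cases hP₀ : A + (B ∩ (b₀ +ᵥ H)) + H = A + (B ∩ (b₀ +ᵥ H))
  · -- every piece is `H`-stable, hence so is `A + B`: PURE BEAT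
    left
    have hstabAB : A + B + H = A + B := by
      refine Subset.antisymm ?_ (hH.subset_add _)
      intro y hy
      obtain ⟨x, hx, k, hk, rfl⟩ := mem_add.1 hy
      obtain ⟨a, ha, b, hb, rfl⟩ := mem_add.1 hx
      have hpiece : A + (B ∩ (b +ᵥ H)) + H = A + (B ∩ (b +ᵥ H)) := by
        by_cases hbb : b ∈ b₀ +ᵥ H
        · rw [hH.coset_eq_of_mem hbb]; exact hP₀
        · exact hgood b hb hbb
      have hmem : a + b ∈ A + (B ∩ (b +ᵥ H)) :=
        add_mem_add ha (mem_inter.2 ⟨hb, hH.mem_coset_self b⟩)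
      have : a + b + k ∈ A + (B ∩ (b +ᵥ H)) := by rw [← hpiece]; exact add_mem_add hmem hk
      exact add_subset_add_left inter_subset_left this
    have hHsub : H ⊆ (A + B).addStab :=
      (hH.add_eq_self_iff_subset_addStab (hA.add hB)).1 hstabAB
    have hP := h.isPurePair hA hB
    have hHA : H ⊆ A.addStab := by rw [hP.1]; exact hHsub
    have hAHeq : A + H = A := (hH.add_eq_self_iff_subset_addStab hA).2 hHA
    have hAeq : A = H := by
      refine Subset.antisymm hAH ?_
      obtain ⟨a, ha⟩ := hA
      have hcos : a +ᵥ H = (0 : G) +ᵥ H := hH.coset_eq_of_mem (hA0 ha)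
      rw [zero_vadd] at hcos
      rw [← hcos]
      exact hH.coset_subset_of_stable hAHeq ha
    have hst := h.addStab_eq hA hB hC
    have hAst : A.addStab = H := by rw [hAeq]; exact hH.addStab_eq
    exact ⟨hAeq, hst.1 ▸ hAst, hst.2 ▸ hst.1 ▸ hAst, hAB⟩
  · -- the piece over `b₀ + H` is incomplete: IMPURE BEAT after translating it to `H`
    right
    have h' : IsMaximalTrio A (-b₀ +ᵥ B) (-(-b₀) +ᵥ C) := h.translate_right (-b₀)
    refine ⟨-b₀, ?_, ?_, ?_, ?_⟩
    · -- `(−b₀ + B) ∖ H` is `H`-stable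
      refine Subset.antisymm ?_ (hH.subset_add _)
      intro y hy
      obtain ⟨b', hb', k, hk, rfl⟩ := mem_add.1 hy
      rw [mem_sdiff] at hb' ⊢
      obtain ⟨hb'B, hb'H⟩ := hb'
      have hbB : b₀ + b' ∈ B := by
        have := (neg_vadd_mem_iff).2 hb'B; rwa [neg_neg, vadd_eq_add] at this
      set b := b₀ + b' with hbdef
      have hbC : b ∉ b₀ +ᵥ H := by
        rw [hH.mem_coset_iff]
        have e : b - b₀ = b' := by rw [hbdef]; abel
        rw [e]; exact hb'H
      have hpiece := hgood b hbB hbC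
      constructor
      · have hsub : A + insert (b' + k) (-b₀ +ᵥ B) ⊆ A + (-b₀ +ᵥ B) := by
          intro z hz
          obtain ⟨a, ha, w, hw, rfl⟩ := mem_add.1 hz
          rcases mem_insert.1 hw with rfl | hw
          · have hab : a + b ∈ A + (B ∩ (b +ᵥ H)) :=
              add_mem_add ha (mem_inter.2 ⟨hbB, hH.mem_coset_self b⟩)
            have habk : a + b + k ∈ A + B := by
              have : a + b + k ∈ A + (B ∩ (b +ᵥ H)) := by
                rw [← hpiece]; exact add_mem_add hab hk
              exact add_subset_add_left inter_subset_left this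
            obtain ⟨a', ha', b'', hb'', he⟩ := mem_add.1 habk
            refine mem_add.2 ⟨a', ha', -b₀ + b'', ?_, ?_⟩
            · have := (vadd_mem_vadd_finset_iff (-b₀)).2 hb''
              rwa [vadd_eq_add] at this
            · calc a' + (-b₀ + b'') = -b₀ + (a' + b'') := by abel
                _ = -b₀ + (a + b + k) := by rw [he]
                _ = a + (b' + k) := by rw [hbdef]; abel
          · exact add_mem_add ha hw
        have htrio : IsTrio A (insert (b' + k) (-b₀ +ᵥ B)) (-(-b₀) +ᵥ C) :=
          fun h0 => h'.1 (add_subset_add_right hsub h0)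
        have heq := (h'.2 Subset.rfl (subset_insert _ _) Subset.rfl htrio).2.1
        rw [← heq]; exact mem_insert_self _ _
      · intro hmem
        apply hb'H
        have := hH.sub_mem hmem hk
        rwa [add_sub_cancel_right] at this
    · rw [h'.eq_third]
    · refine ⟨0, mem_inter.2 ⟨?_, hH.zero_mem⟩⟩
      have := (vadd_mem_vadd_finset_iff (-b₀)).2 hb₀
      rwa [vadd_eq_add, neg_add_cancel] at this
    · -- some point of the coset `b₀ + H` is missed by `A + B`; its negative lies in `C`
      have hP₀sub : A + (B ∩ (b₀ +ᵥ H)) ⊆ b₀ +ᵥ H := by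
        have := hH.add_subset_coset hA0 (inter_subset_right : B ∩ (b₀ +ᵥ H) ⊆ b₀ +ᵥ H)
        rwa [zero_add] at this
      have hne : A + (B ∩ (b₀ +ᵥ H)) ≠ b₀ +ᵥ H := by
        intro heq; apply hP₀; rw [heq]; exact hH.coset_add b₀
      obtain ⟨y, hy, hyP⟩ := exists_of_ssubset (hP₀sub.ssubset_of_ne hne)
      have hyAB : y ∉ A + B := by
        intro hy'
        obtain ⟨a, ha, b, hb, rfl⟩ := mem_add.1 hy'
        apply hyP
        refine add_mem_add ha (mem_inter.2 ⟨hb, ?_⟩)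
        rw [hH.mem_coset_iff] at hy ⊢
        have := hH.sub_mem hy (hAH ha)
        have e : a + b - b₀ - a = b - b₀ := by abel
        rwa [e] at this
      have hyC : -y ∈ C := by rw [hAB, mem_third, neg_neg]; exact hyAB
      refine ⟨b₀ + -y, mem_inter.2 ⟨?_, ?_⟩⟩
      · rw [neg_neg]
        have := (vadd_mem_vadd_finset_iff b₀).2 hyC
        rwa [vadd_eq_add] at this
      · rw [hH.mem_coset_iff] at hy
        have := hH.neg_mem hy
        have e : -(y - b₀) = b₀ + -y := by abel
        rwa [e] at this

end Beat

/-! ## §6. Purification: the set deficiency, Mann's theorem, Lemmas 6.2–6.3 -/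

section Purification

variable [Fintype G] {H A B C : Finset G}

/-- The DEFICIENCY OF A SET: `δ(A) = max_{B ≠ ∅, A + B ≠ G} δ(A,B)` ("Here we only consider finite
nonempty sets `B`"), computed in `ℕ` with `δ(A,B) = |A| + |B| − |A + B|` (truncated at `0`; for a
proper nonempty `A` the maximum is `≥ 1`, attained values are never truncated — see
`exists_setDeficiency_eq`). [cite: BoothbyDevosMontejano2013, §6] -/
def setDeficiency (A : Finset G) : ℕ :=
  ((univ : Finset (Finset G)).filter fun B => B.Nonempty ∧ A + B ≠ univ).sup
    fun B => #A + #B - #(A + B)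

/-- Unfolding lemma. [cite: BoothbyDevosMontejano2013, §6] -/
theorem setDeficiency_def (A : Finset G) : setDeficiency A =
    ((univ : Finset (Finset G)).filter fun B => B.Nonempty ∧ A + B ≠ univ).sup
      fun B => #A + #B - #(A + B) := rfl

/-- Every admissible `B` bounds `δ(A)` from below: `δ(A,B) ≤ δ(A)`, i.e.
`|A| + |B| ≤ |A + B| + δ(A)`. [cite: BoothbyDevosMontejano2013, §6] -/
theorem card_add_card_le_setDeficiency (hB : B.Nonempty) (hAB : A + B ≠ univ) :
    #A + #B ≤ #(A + B) + setDeficiency A := by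
  have : #A + #B - #(A + B) ≤ setDeficiency A := by
    rw [setDeficiency_def]
    exact le_sup (f := fun B => #A + #B - #(A + B)) (mem_filter.2 ⟨mem_univ _, hB, hAB⟩)
  omega

/-- The maximum is attained, at a critical pair: for `∅ ≠ A ≠ G` there is `B ≠ ∅` with `A + B ≠ G`
and `δ(A,B) = δ(A) ≥ 1` ("the maximum in the formula will be obtained").
[cite: BoothbyDevosMontejano2013, §6] -/
theorem exists_setDeficiency_eq (hAu : A ≠ univ) :
    ∃ B : Finset G, B.Nonempty ∧ A + B ≠ univ ∧ #(A + B) + setDeficiency A = #A + #B ∧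
      #(A + B) < #A + #B := by
  classical
  have h0 : ({0} : Finset G) ∈ (univ : Finset (Finset G)).filter
      fun B => B.Nonempty ∧ A + B ≠ univ := by
    refine mem_filter.2 ⟨mem_univ _, singleton_nonempty 0, ?_⟩
    rwa [singleton_zero, add_zero]
  obtain ⟨B, hBmem, hBeq⟩ := exists_mem_eq_sup _ ⟨{0}, h0⟩ (fun B => #A + #B - #(A + B))
  rw [mem_filter] at hBmem
  have h1 : 1 ≤ setDeficiency A := by
    have := card_add_card_le_setDeficiency (A := A) (singleton_nonempty (0 : G))
      (by rwa [singleton_zero, add_zero])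
    rw [singleton_zero, add_zero, card_zero] at this
    omega
  rw [← setDeficiency_def] at hBeq
  refine ⟨B, hBmem.2.1, hBmem.2.2, ?_, ?_⟩ <;> omega

/-- **Theorem 6.1 (Mann).**  "If `A ⊂ G` is finite and nonempty, there exists a finite subgroup
`H < G` with `δ(A,H) = δ(A)` and `A + H ≠ G`."  Proof as printed: take `B` attaining `δ(A)` and
`H = stab(A + B)`; Kneser gives `δ(A,B) ≤ δ(A,H)`, and `|A + H| ≤ |A + B| < |G|`.
[cite: BoothbyDevosMontejano2013, Thm 6.1] -/
theorem exists_subgroupCarrier_setDeficiency_eq (hA : A.Nonempty) (hAu : A ≠ univ) :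
    ∃ H : Finset G, IsSubgroupCarrier H ∧ A + H ≠ univ ∧
      #(A + H) + setDeficiency A = #A + #H := by
  obtain ⟨B, hB, hABu, hBeq, hcrit⟩ := exists_setDeficiency_eq hAu
  set H := (A + B).addStab with hHdef
  have hH : IsSubgroupCarrier H := IsSubgroupCarrier.of_addStab (hA.add hB)
  have hk := add_kneser A B
  rw [← hHdef] at hk
  -- `|A + H| ≤ |A + B|`: a translate of `A + H` lies in `A + B`
  obtain ⟨b, hb⟩ := hB
  have hAH : #(A + H) ≤ #(A + B) := by
    rw [← card_vadd_finset b (A + H)]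
    refine card_le_card fun x hx => ?_
    rw [← neg_vadd_mem_iff, vadd_eq_add] at hx
    obtain ⟨a, ha, k, hkH, hx⟩ := mem_add.1 hx
    have hab : a + b + k ∈ A + B := by
      rw [← add_addStab (A + B), ← hHdef]; exact add_mem_add (add_mem_add ha hb) hkH
    have e : a + b + k = x := by rw [add_right_comm, hx]; abel
    rwa [e] at hab
  have hAHu : A + H ≠ univ := by
    intro hu
    have : #(A + B) < #(univ : Finset G) := card_lt_card (ssubset_univ_iff.2 hABu)
    rw [hu] at hAH
    omega
  refine ⟨H, hH, hAHu, le_antisymm ?_ (card_add_card_le_setDeficiency hH.nonempty hAHu)⟩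
  have hBH : #B ≤ #(B + H) := card_le_card_add_right hH.nonempty
  omega

omit [Fintype G] in
/-- **Lemma 6.2.**  "Let `H < G` and `A ⊂ G` be finite and assume `(A,H)` is critical.  If
`B ⊆ H`, then `δ(A,B) ≤ δ(A,H)`" — for nonempty `A`, `B`, stated as
`|B| + |A + H| ≤ |A + B| + |H|`.  Proof as printed: with `K` the closure of `B` (`K ≤ H`),
Lemma 5.2 gives `δ(A,B) ≤ δ(A,K)`; and `δ(A,K) ≤ δ(A,H)` by splitting `S = (A + H) ∖ A` into
`S' = {g ∈ S : g + K ⊆ S}` (`K`-stable, so `|S'| ≤ |H| − |K|`) and `S'' ⊆ (A + K) ∖ A`.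
[cite: BoothbyDevosMontejano2013, Lemma 6.2] -/
theorem card_add_card_add_le_of_subset_carrier (hH : IsSubgroupCarrier H)
    (hcritH : #(A + H) < #A + #H) (hA : A.Nonempty) (hB : B.Nonempty) (hBH : B ⊆ H) :
    #B + #(A + H) ≤ #(A + B) + #H := by
  classical
  by_cases hcrit : #(A + B) < #A + #B
  swap
  · omega
  -- the closure `K` of `B`, a subgroup carrier inside `H`
  have hfin : ∃ K : Finset G, IsSubgroupCarrier K ∧ ClosureIs K B := by
    let S : Finset (Finset G) :=
      H.powerset.filter fun K => IsSubgroupCarrier K ∧ ∃ b : G, B ⊆ b +ᵥ K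
    have hne : S.Nonempty :=
      ⟨H, mem_filter.2 ⟨mem_powerset.2 Subset.rfl, hH, 0, by rwa [zero_vadd]⟩⟩
    obtain ⟨K, hK, hmin⟩ := exists_min_image S card hne
    rw [mem_filter, mem_powerset] at hK
    refine ⟨K, hK.2.1, hK.2.2, fun K' hK' hK'K hBK' => ?_⟩
    have hle := hmin K' (mem_filter.2 ⟨mem_powerset.2 (hK'K.trans hK.1), hK', hBK'⟩)
    exact eq_of_subset_of_card_le hK'K hle
  obtain ⟨K, hK, hclK⟩ := hfin
  have hKH : K ⊆ H := hclK.subset hK hH ⟨0, by rwa [zero_vadd]⟩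
  -- Lemma 5.2 (second part) for the pair `(B, A)`: `δ(A,B) ≤ δ(A,K)`
  have h52 : #B + #(K + A) ≤ #(B + A) + #K :=
    card_add_card_add_le_of_critical hK hclK hB hA (by rw [add_comm B A]; omega)
  rw [add_comm K A, add_comm B A] at h52
  -- `δ(A,K) ≤ δ(A,H)`
  set S := (A + H) \ A with hSdef
  set S' := S.filter fun g => g +ᵥ K ⊆ S with hS'def
  have hAAH : A ⊆ A + H := hH.subset_add A
  have hAAK : A ⊆ A + K := hK.subset_add A
  have hScard : #S + #A = #(A + H) := by rw [hSdef, card_sdiff_add_card_eq_card hAAH]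
  have hS'stab : S' + K = S' := by
    refine Subset.antisymm ?_ (hK.subset_add _)
    intro y hy
    obtain ⟨g, hg, k, hk, rfl⟩ := mem_add.1 hy
    rw [hS'def, mem_filter] at hg ⊢
    have hgk : g + k ∈ g +ᵥ K := (hK.mem_coset_iff).2 (by rw [add_sub_cancel_left]; exact hk)
    refine ⟨hg.2 hgk, ?_⟩
    rw [hK.coset_eq_of_mem hgk]; exact hg.2
  have hS'le : #S' + #K ≤ #H := by
    have hdvd1 : #K ∣ #S' := hK.card_dvd_of_stable hS'stab
    have hdvd2 : #K ∣ #H := hK.card_dvd_of_subset hH hKH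
    have hlt : #S' < #H := by
      have : #S' ≤ #S := card_filter_le _ _
      omega
    obtain ⟨i, hi⟩ := hdvd1
    obtain ⟨j, hj⟩ := hdvd2
    rw [hi, hj] at hlt ⊢
    have hij : i < j := Nat.lt_of_mul_lt_mul_left hlt
    calc #K * i + #K = #K * (i + 1) := by ring
      _ ≤ #K * j := Nat.mul_le_mul_left _ hij
  have hSsub : S ⊆ S' ∪ ((A + K) \ A) := by
    intro g hg
    rw [mem_union]
    by_cases hgS : g +ᵥ K ⊆ S
    · exact Or.inl (mem_filter.2 ⟨hg, hgS⟩)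
    · right
      obtain ⟨x, hx, hxS⟩ := not_subset.1 hgS
      rw [hSdef, mem_sdiff] at hg
      have hxAH : x ∈ A + H := by
        have hxg : x - g ∈ K := (hK.mem_coset_iff).1 hx
        have : g + (x - g) ∈ A + H + H := add_mem_add hg.1 (hKH hxg)
        rwa [hH.add_add_self, add_sub_cancel] at this
      have hxA : x ∈ A := by
        by_contra hxA; exact hxS (by rw [hSdef, mem_sdiff]; exact ⟨hxAH, hxA⟩)
      rw [mem_sdiff]
      refine ⟨?_, hg.2⟩
      have hgx : g - x ∈ K := by
        have := hK.neg_mem ((hK.mem_coset_iff).1 hx)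
        rwa [neg_sub] at this
      have := add_mem_add hxA hgx
      rwa [add_sub_cancel] at this
  have hScard' : #S ≤ #S' + #((A + K) \ A) := (card_le_card hSsub).trans (card_union_le _ _)
  rw [card_sdiff_of_subset hAAK] at hScard'
  have hAKle : #A ≤ #(A + K) := card_le_card hAAK
  omega

/-- The third set of a union: `third A (B ∪ R) = third A B ∩ third A R`.
[cite: BoothbyDevosMontejano2013, Lemma 6.3 (proof)] -/
theorem third_union (A B R : Finset G) : third A (B ∪ R) = third A B ∩ third A R := by
  ext c
  simp only [mem_third, mem_inter, add_union, mem_union, not_or]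

/-- "Since `(A,B,C)` and `(A,R,S)` are trios, it follows that both `(A, B ∪ R, C ∩ S)` and
`(A, B ∩ R, C ∪ S)` are trios" — first half. [cite: BoothbyDevosMontejano2013, Lemma 6.3 (proof)] -/
theorem IsTrio.union_inter (h : IsTrio A B C) (R : Finset G) :
    IsTrio A (B ∪ R) (C ∩ third A R) := by
  rw [isTrio_iff_subset_third, third_union]
  exact inter_subset_inter (isTrio_iff_subset_third.1 h) Subset.rfl

/-- Second half: `(A, B ∩ R, C ∪ third A R)` is a trio. [cite: BoothbyDevosMontejano2013, Lemma 6.3 (proof)] -/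
theorem IsTrio.inter_union (h : IsTrio A B C) (R : Finset G) :
    IsTrio A (B ∩ R) (C ∪ third A R) := by
  rw [isTrio_iff_subset_third]
  exact union_subset ((isTrio_iff_subset_third.1 h).trans (third_mono Subset.rfl inter_subset_left))
    (third_mono Subset.rfl inter_subset_right)

omit [AddCommGroup G] in
/-- The deficiency bookkeeping of purification:
`δ(A, B ∪ R, C ∩ S) + δ(A, B ∩ R, C ∪ S) = δ(A,B,C) + δ(A,R,S)`.
[cite: BoothbyDevosMontejano2013, Lemma 6.3 (proof)] -/
theorem trioDeficiency_union_inter_add (A B C R S : Finset G) :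
    trioDeficiency A (B ∪ R) (C ∩ S) + trioDeficiency A (B ∩ R) (C ∪ S) =
      trioDeficiency A B C + trioDeficiency A R S := by
  unfold trioDeficiency
  have h1 : (#(B ∪ R) : ℤ) + #(B ∩ R) = #B + #R := by exact_mod_cast card_union_add_card_inter B R
  have h2 : (#(C ∪ S) : ℤ) + #(C ∩ S) = #C + #S := by exact_mod_cast card_union_add_card_inter C S
  linarith

/-- **Lemma 6.3 (Purification).**  "Let `(A,B,C)` be a critical trio in `G`, let `H ≤ G`, and assume
`A` and `H` are finite and `(A,H)` is critical.  If `R ∈ G/H` satisfies `∅ ≠ R ∩ B ≠ R` and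
`S = third A R`, then `δ(A, B ∪ R, C ∩ S) ≥ δ(A,B,C)`."  (The printed proof uses neither the
criticality of the trio nor `R ⊄ B`; both are dropped here; `A ≠ ∅` is used.)  Proof as printed:
the bookkeeping identity, `δ(A,R,S) = δ(A,R) = δ(A,H) ≥ δ(A, B ∩ R)` (Lemma 6.2 after translating
`B ∩ R` into `H`) `≥ δ(A, B ∩ R, C ∪ S)`. [cite: BoothbyDevosMontejano2013, Lemma 6.3] -/
theorem IsTrio.trioDeficiency_le_purify (htrio : IsTrio A B C) (hA : A.Nonempty)
    (hH : IsSubgroupCarrier H) (hcritH : #(A + H) < #A + #H) (r : G)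
    (hRB : (B ∩ (r +ᵥ H)).Nonempty) :
    trioDeficiency A B C ≤ trioDeficiency A (B ∪ (r +ᵥ H)) (C ∩ third A (r +ᵥ H)) := by
  set R := r +ᵥ H with hRdef
  set S := third A R with hSdef
  have hbook := trioDeficiency_union_inter_add A B C R S
  -- `δ(A,R,S) = δ(A,H)`
  have hRS : trioDeficiency A R S = (#A : ℤ) + #H - #(A + H) := by
    rw [hSdef, trioDeficiency_third, hRdef, Grynkiewicz.add_vadd_finset, card_vadd_finset, card_vadd_finset]
  -- `δ(A, B ∩ R, C ∪ S) ≤ δ(A, B ∩ R) ≤ δ(A,H)`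
  have h1 : trioDeficiency A (B ∩ R) (C ∪ S) ≤ (#A : ℤ) + #(B ∩ R) - #(A + (B ∩ R)) :=
    (htrio.inter_union R).trioDeficiency_le
  have h2 : #(B ∩ R) + #(A + H) ≤ #(A + (B ∩ R)) + #H := by
    have hsub : -r +ᵥ (B ∩ R) ⊆ H := by
      intro x hx
      rw [← neg_vadd_mem_iff, neg_neg] at hx
      have := (mem_inter.1 hx).2
      rw [hRdef, hH.mem_coset_iff, vadd_eq_add, add_sub_cancel_left] at this
      exact this
    have := card_add_card_add_le_of_subset_carrier hH hcritH hA (hRB.vadd_finset (a := -r)) hsub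
    rwa [card_vadd_finset, Grynkiewicz.add_vadd_finset, card_vadd_finset] at this
  have h2' : (#(B ∩ R) : ℤ) + #(A + H) ≤ #(A + (B ∩ R)) + #H := by exact_mod_cast h2
  linarith

/-- **Purification for pairs** ("the above lemma also applies to pairs"): if `(A,H)` is critical and
the coset `R = r + H` meets `B`, then `δ(A, B ∪ R) ≥ δ(A,B)`, stated as
`|B| + |A + (B ∪ R)| ≤ |A + B| + |B ∪ R|`.  (The paper also assumes `(A,B)` critical; not needed.)
[cite: BoothbyDevosMontejano2013, Lemma 6.3 (remark)] -/
theorem card_add_union_coset_le (hA : A.Nonempty) (hH : IsSubgroupCarrier H)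
    (hcritH : #(A + H) < #A + #H) (r : G) (hRB : (B ∩ (r +ᵥ H)).Nonempty) :
    #B + #(A + (B ∪ (r +ᵥ H))) ≤ #(A + B) + #(B ∪ (r +ᵥ H)) := by
  have h := (isTrio_third A B).trioDeficiency_le_purify hA hH hcritH r hRB
  rw [trioDeficiency_third] at h
  have h' := ((isTrio_third A B).union_inter (r +ᵥ H)).trioDeficiency_le
  have : (#B : ℤ) + #(A + (B ∪ (r +ᵥ H))) ≤ #(A + B) + #(B ∪ (r +ᵥ H)) := by linarith
  exact_mod_cast this

end Purification


/-! ## Theorem 3.3: Vosper's theorem for trios -/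

section VosperTrio

variable {p : ℕ} [hp : Fact p.Prime] {A B C : Finset (ZMod p)}

/-- **Theorem 3.3 (Vosper, version II).**  "If `(A,B,C)` is a nontrivial critical trio in `ℤ/pℤ`
and `p` is prime, then one of the following holds. 1. `min{|A|, |B|, |C|} = 1`.  2. `A`, `B`, and
`C` are arithmetic progressions with a common difference."  ("Vosper's Theorem has a convenient
restatement in terms of trios, as the extra symmetry in a trio eliminates one of the outcomes (and
assuming nontriviality eliminates another).")  Proof: `(A,B)` is a critical pair with
`A + B ≠ ℤ/pℤ` and `|A + B| ≤ p − |C| ≤ p − 2`, so Vosper's theorem (`vosper_inverse`,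
`Vosper.lean`) makes `A`, `B` progressions with one difference `d ≠ 0`; then `A + B`, `−(A + B)` and
`third A B = (−(A+B))ᶜ` are progressions with difference `d` (`IsAP.add`, `IsAP.neg`, `IsAP.compl`),
and criticality forces `C = third A B`. [cite: BoothbyDevosMontejano2013, Thm 3.3] -/
theorem IsTrio.vosper_trio (h : IsTrio A B C) (hδ : 0 < trioDeficiency A B C) (hA : A.Nonempty)
    (hB : B.Nonempty) (hC : C.Nonempty) :
    min (min #A #B) #C = 1 ∨ ∃ d : ZMod p, d ≠ 0 ∧ IsAP A d ∧ IsAP B d ∧ IsAP C d := by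
  have hG : A + B ≠ univ := h.add_ne_univ hC
  have hcrit : #(A + B) < #A + #B := h.card_add_lt hδ
  have hcd := Vosper.cauchy_davenport_of_ne_univ hA hB hG
  have hCsub : C ⊆ third A B := isTrio_iff_subset_third.1 h
  have hCle : #C ≤ #(third A B) := card_le_card hCsub
  have hthird := card_third_add_card_add A B
  have hp' : Fintype.card (ZMod p) = p := ZMod.card p
  by_cases hA1 : #A = 1
  · left; rw [hA1]; have := hB.card_pos; have := hC.card_pos; omega
  by_cases hB1 : #B = 1
  · left; rw [hB1]; have := hA.card_pos; have := hC.card_pos; omega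
  by_cases hC1 : #C = 1
  · left; rw [hC1]; have := hA.card_pos; have := hB.card_pos; omega
  right
  have h2A : 2 ≤ #A := by have := hA.card_pos; omega
  have h2B : 2 ≤ #B := by have := hB.card_pos; omega
  have h2C : 2 ≤ #C := by have := hC.card_pos; omega
  have hABcard : #(A + B) = #A + #B - 1 := by omega
  have hsmall : #(A + B) ≤ p - 2 := by omega
  obtain ⟨d, hd, hAd, hBd⟩ := vosper_inverse h2A h2B hABcard hsmall
  refine ⟨d, hd, hAd, hBd, ?_⟩
  have hABd : IsAP (A + B) d := hAd.add hBd (by omega)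
  have hthird_d : IsAP (third A B) d := by rw [third]; exact hABd.neg.compl hd
  have hCeq : C = third A B := by
    refine eq_of_subset_of_card_le hCsub ?_
    unfold trioDeficiency at hδ
    omega
  rw [hCeq]; exact hthird_d

end VosperTrio

end Literature.Combinatorics.Additive
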